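import Literature.Geometry.Kaehler.ComplexTorusAlbertTypeIIIShimura
import Literature.Geometry.Kaehler.ComplexTorusIsotypicalDecomposition
import Mathlib.LinearAlgebra.Dual.Lemmas
import HarnessLib

/-!
# Hulek–Laface 2019 Prop. 5.1, exceptional case (1) as printed: a polarised torus with totally definite
# quaternion multiplication of full degree (`m = 1`) is isogenous to a square `Y × Y`, `Y` of CM type

Layer `Literature/Geometry/Kaehler`, namespace `Literature.Geometry.Kaehler.ComplexTorus`; lane `lit-hodgefound`
(Track 2 foundations library), SKELETON row A2-32 «Albert classification of `End_ℚ` of a simple AV (types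
I–IV)»; seat p18 gen 10, row g10-#1.  THEOREMS ONLY (no definition, no named fact; D-0026, net debt 0).
Sequel of `ComplexTorusAlbertTypeIIIShimura.lean` (p12 g10-#4: the SIMPLE case — "`dim_ℚ End_ℚ(X) ≠ rk Λ` for
a simple torus of type III", i.e. `m ≠ 1`; its closing line HOME/INBOX l.4047 lists the present «contains» form
as successor (c)), of `ComplexTorusAbelianSurfaceDefiniteQuaternionMultiplication.lean` (p18 g9-#4/#5: the
instance `g = 2`, `X ∼ E_τ × E_τ` with `E_τ` CM) and of `ComplexTorusIsotypicalDecomposition.lean` (p10: the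
torus `X^ε` of an idempotent, `X ∼ X^{e₊} × X^{e₋}` for an involution, conjugate idempotents).

## The print

K. Hulek, R. Laface, *On the Picard numbers of abelian varieties*, Ann. Sc. Norm. Super. Pisa (2019), §5.1
(held text `paper:arxiv-1703.05882`, p0010), **Proposition 5.1**, VERBATIM: «Let `g` be a fixed positive
integer. For all positive integers `ρ` that satisfy one of the conditions above, there exists a simple abelian
variety `X` of the corresponding type such that `ρ(X) = ρ`, unless we are in one of the five following
exceptional cases: • `F` is of type III, and `m := g/2e = 1`; […] *Proof.* It is a theorem of Shimura that
given an endomorphism structure `(F, ′, ι)` one has that a general member `(X, H, ι)` of the moduli space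
`𝒜(ℳ, T)` has the property `End_ℚ(X) = ι(F)`, except in the cases above (for example see [shimura63], or
[birkenhake-lange04] for a modern approach).  In fact, under the assumption that our abelian variety `X` be
simple, one can show that these cases never occur: • `X` is isogenous to a square `Y²`, where `Y` is an abelian
variety of dimension `e₀`, contradicting the fact that `X` is simple; […] For details, consult
[birkenhake-lange04], or see the original paper by Shimura [shimura63].»  Here (HL §2; Lange §2.6.1 table,
p0138) for type III `F` is a totally definite quaternion algebra over a totally real field `K`, `e = [K : ℚ]`,
`[F : ℚ] = 4e`, the positive anti-involution is `x′ = x̄` (Lange Thm. 2.6.5 (c), p0141), and `m := g/2e = 1`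
means `[F : ℚ] = 2g = rk Λ`.  The original, G. Shimura, *On analytic families of polarized abelian varieties
and automorphic functions*, Ann. of Math. 78 (1963) §4, is paywalled here (acquisition `acq-05438`,
cite-only) and is cited THROUGH Hulek–Laface, as in p12's file; Birkenhake–Lange (2004) §9 is not held either.

## What is proved — the «contains» form, every dimension, at torus level

Throughout: `X = E/Ψ(ℤ^κ)` a complex torus with a Riemann form `η` (polarised), `G ∈ M_κ(ℚ)` the rational
Gram matrix of `η` on the lattice basis, `† = rosati G` the Rosati involution, `End_ℚ(X) = endAlgRat Ψ`,
`|κ| = rk Λ = 2 dim X`; and `F ⊆ End_ℚ(X)` a `ℚ`-subalgebra with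

* `hFr`  — `F` is `†`-stable (the endomorphism structure `ι : F → End_ℚ(X)` is compatible with `(′, †)`,
  i.e. `(X, H, ι) ∈ 𝒜(ℳ, T)`);
* `hdiv` — `F` is a skew field (every non-zero element is an invertible matrix);
* `hcen`, `hfk` — `A + A† ∈ Z(F)` for `A ∈ F` and `z† = z` for `z ∈ Z(F)`: `†|_F` is of the first kind with
  `x + x′` central, the shape `x′ = x̄` of Thm. 2.6.5 (c) — by Lange Thm. 2.6.5 the positive pairs of this
  shape are exactly type III (totally definite quaternion algebra over its totally real centre) and the
  commutative type I, and for type I the remaining hypothesis is contradictory (no non-zero skew element);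
* `hdim` — `dim_ℚ F = |κ| = rk Λ`, i.e. `m = 1`.

Under these hypotheses (positivity `Tr(A†A) > 0` on `F` being automatic, Lange Thm. 2.4.9 =
`trace_rosati_mul_self_pos_rat`):

* §3 **`exists_isIsogenous_powPeriod_two_of_typeIII_sub`** — THE PRINTED CONCLUSION: there is an idempotent
  `0 ≠ P ≠ 1` of `End_ℚ(X)` with **`X ∼ X^P × X^P`** (`IsIsogenous Ψ (powPeriod (idemPeriod Ψ P) 2)`) and
  **`rk Λ(X^P) = ½ rk Λ`** (`2 · subRank (idemSubspace P) = |κ|`); in complex dimensions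
  `exists_isIsogenous_powPeriod_two_finrank_of_typeIII_sub`: `2 dim_ℂ X^P = dim_ℂ X`;
  **`not_isSimple_of_typeIII_sub`** («contradicting the fact that `X` is simple»: a non-trivial idempotent);
  **`exists_mem_endAlgRat_not_mem_of_typeIII_sub`** (`End_ℚ(X) ⊋ F`: the non-zero skew commutant element
  `a` with `a² = ξ²`, `ξ ∈ F` — Shimura's "general member does NOT have `End_ℚ(X) = ι(F)`" in this case).
* §4 **`card_eq_four_mul_finrank_center_of_typeIII_sub`** — `rk Λ = [F:ℚ] = 4e` with `e = dim_ℚ Z(F)`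
  (`Z(F) = F ∩ C(F)`): the quaternion numerology `[F : Z(F)] = 4`, `dim X = 2e` is forced;
  **`exists_isIsogenous_powPeriod_two_cm_of_typeIII_sub`** — the square TOGETHER WITH the complex
  multiplication of the factor: `rk Λ(X^P) = 2e` («`Y` of dimension `e`») and `End_ℚ(X^P)` contains a
  commutative `ℚ`-subalgebra which is a field, of `ℚ`-dimension `rk Λ(X^P) = 2 dim X^P` — "a field of degree
  `2 dim Y` in `End_ℚ(Y)`", the tree's currency for complex multiplication (Shimura 1998 §5.1 Prop. 3;
  `ComplexTorusEndomorphismSubfields`, `EndomorphismFieldOfFullDegree`).  This refines the print: Shimura's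
  family of type III with `m = 1` is zero-dimensional, its members are of CM type; at `g = 2` it is the
  tree's `X ∼ E_τ²`, `E_τ` CM (`ComplexTorusAbelianSurfaceDefiniteQuaternionMultiplication` §3).
* §5 (add-only rider) **`isTotallyReal_of_range_eq_center_of_typeIII_sub`** — a number field embedded onto
  the centre `Z(F)` is totally real (`†` is the identity there; Lange Lemma 2.6.4, the tree's
  `forall_rosati_algHom_eq_iff_isTotallyReal`); **`exists_skew_isCMField_of_typeIII_sub`** — `L = F ∩ C(ξ)`
  is `†`-stable (`rosati_mem_inf_centralizer_of_skew`) with `ξ† = -ξ ≠ ξ`, so every number field embedded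
  onto `L` is a CM field (Lange Lemma 2.6.6, the tree's `isCMField_of_rosati_ne`): the factor `Y = X^P` has
  complex multiplication by the CM field `Z(F)(ξ)`.

## Proof route (declared deviation: Hulek–Laface refer to Shimura's analytic families [shimura63, §4] and to
Birkenhake–Lange §9, neither held; the proof here is an elementary RATIONAL one, extending p12's descent)

§1 `exists_skew_sq_central_and_commutant` — the constructive rank-one model (the engine of p12's
`exists_skew_mem_centralizer_forall_commute`, RE-RUN because its internal objects are private there and the
exported `∃`-statement does not carry them): `Λ_ℚ = F·v ≅ F`; the polarisation reads `(Av, Bv) ↦ Tr(ξ A†B)`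
for a unique `ξ ∈ F`, `ξ† = -ξ ≠ 0`, `q = ξ²` central; the commutant `C(F)` is the algebra of right
multiplications `R_ζ`; `a := R_ξ ∈ C(F)` is non-zero, skew, **`a² = R_{ξ²} = L_{ξ²} = ξ²`** (new output), and
commutes with every skew element of `C(F)`.  §3 Step 1 `exists_skew_data_of_typeIII_sub`: `a ∈ End_ℚ(X)` by
p12's `mem_endAlgRat_of_forall_skew_centralizer_commute` BY NAME (`J ∈ C(End_ℚ X) ⊗ ℝ ⊆ C(F) ⊗ ℝ` descends
through the skew part); `ξ ∉ Z(F)` and `a ∉ F` (else `†`-fixed AND skew); §2 an anticommuting partner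
`j = ξyξ - ξ²y ∈ F` (`jξ = -ξj`, `exists_mem_anticommute`) and the involution **`T = ξ a (ξ²)⁻¹ ∈ End_ℚ(X)`**:
`T² = ξ²a²(ξ²)⁻² = 1`, `jT = -Tj`, hence `Tr T = 0`, `T ≠ ±1` (`involution_mem_endAlgRat`).  Step 4
`involutionIdempotent_square`: `P = ½(1 + T)` (p10's `involutionIdempotent`), `X ∼ X^P × X^{1-P}`
(`isIsogeny_sum_involution`), `1 - P = jPj⁻¹` (`one_sub_involutionIdempotent_eq_conj`) so
`X^{1-P} ∼ X^P` (`isIsogenous_idemPeriod_conj_of_unit`) and `X ∼ (X^P)²` (`IsIsogenous.sigmaPi_powPeriod`);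
`rk Λ(X^P) = Tr P = ½(|κ| + Tr T)` (`trace_eq_finrank_idemSubspace`).  §4 `L = F ∩ C(ξ)`: symmetric elements
of `F` are central (`2x = x + x†`), so for `A, B ∈ L` the skew parts `w_A, w_B` commute with `ξ`, `w_Aξ`,
`w_Bξ` are symmetric hence central, and `w_Aw_Bξ² = (w_Aξ)(w_Bξ) = w_Bw_Aξ²` — `L` is commutative
(`mul_comm_of_commute_skew`); `F = L ⊕ Lj` as the `±1`-eigenspaces of `x ↦ ξxξ⁻¹`, `x ↦ jx` exchanging them
(`finrank_eq_two_mul_finrank_inf_centralizer`: `[F:ℚ] = 2[L:ℚ]`); `L = Z(F) ⊕ Z(F)ξ` as the `†`-symmetric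
and `†`-skew parts, `x ↦ xξ` exchanging them (`finrank_inf_centralizer_eq_two_mul_finrank_center`:
`[L:ℚ] = 2[Z(F):ℚ]`); `L` commutes with `T` and `P` and restricts injectively, as a `ℚ`-algebra homomorphism
`A ↦ A|_{X^P}` (p10's `restrictEnd`, `restrictEnd_mul`, `subtorusMatrix_mul_restrictEnd`), into
`End_ℚ(X^P)`, with invertible images of non-zero elements.

## Dictionary with the tree's typed Albert predicates

For `F = End_ℚ(X)` of a SIMPLE `X` and `h : IsAlbertTypeIII (centerField Ψ hX) (endAlgRat Ψ) (rosatiEnd …)`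
(`RingTheory/CentralSimple/AlbertTypes`), the hypotheses hold with `hcen` =
`IsSimple.add_rosati_mul_comm_of_isAlbertTypeIII` (p12) and `hfk` = `h.isOfFirstKind`; there the conclusion
`¬ IsSimple` is p12's `IsSimple.finrank_endAlgRat_ne_card_of_isAlbertTypeIII`, which is therefore not
re-stated.  For a proper subalgebra `F ⊊ End_ℚ(X)` the four elementary hypotheses ARE the statement
"`(F, †|_F)` is a positive pair of type III with `m = 1`" in matrix form (Lange Thm. 2.6.5 (c));
`card_eq_four_mul_finrank_center_of_typeIII_sub` recovers `[F : Z(F)] = 4` from them.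

## References

* [HulekLaface2019PicardNumbersAV] K. Hulek, R. Laface, *On the Picard numbers of abelian varieties*, Ann. Sc.
  Norm. Super. Pisa Cl. Sci. (5) XIX (2019), §2 and §5.1 Prop. 5.1 with proof, exceptional case (1)
  (arXiv 1703.05882, p. 10).
* [Shimura1963AnalyticFamilies] G. Shimura, *On analytic families of polarized abelian varieties and automorphic
  functions*, Ann. of Math. (2) 78 (1963), 149–192, §4 (through Hulek–Laface; acq-05438, cite-only).
* [Lange2023AbelianVarietiesComplex] H. Lange, *Abelian Varieties over the Complex Numbers* (2023), §2.4.1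
  Thm. 2.4.9, §2.4.3–2.4.4 (`X^ε`, Cor. 2.4.28 `dim X^ε = Tr ε`), §2.6.1 table (p. 138), §2.6.2 Thm. 2.6.5 (c)
  (pp. 141–142).
* [LangeRecillas2004] H. Lange, S. Recillas, *Abelian varieties with group action*, J. reine angew. Math. 575
  (2004), §1 Prop. 1.1, §2 Prop. 2.1 (the case `G = ℤ/2ℤ`; conjugate idempotents).
* [Shimura1998] G. Shimura, *Abelian Varieties with Complex Multiplication and Modular Functions* (1998), §5.1
  Props. 1, 3 (a field of degree `2n` in `End_ℚ(A)`).
-/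

noncomputable section

open Module Matrix

namespace Literature.Geometry.Kaehler

namespace ComplexTorus

/-! ## §0 Two pieces of matrix algebra -/

section MatrixAlgebra

variable {ι : Type*} [Fintype ι] [DecidableEq ι] {K : Type*} [Field K]

/-- A subalgebra of a matrix algebra over a field contains the inverses of its invertible elements
(left multiplication by an invertible `A ∈ S` is an injective, hence surjective, linear endomorphism of
the finite-dimensional space `S`, so `A s = 1` for some `s ∈ S`). [folklore] -/
private theorem nonsing_inv_mem_subalgebra (S : Subalgebra K (Matrix ι ι K)) {A : Matrix ι ι K} (hA : A ∈ S)
    (hu : IsUnit A.det) : A⁻¹ ∈ S := by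
  let f : S →ₗ[K] S := LinearMap.mulLeft K (⟨A, hA⟩ : S)
  have hf : Function.Injective f := by
    intro s t hst
    have h1 : A * (s : Matrix ι ι K) = A * (t : Matrix ι ι K) := congrArg Subtype.val hst
    have h2 : A⁻¹ * (A * (s : Matrix ι ι K)) = A⁻¹ * (A * (t : Matrix ι ι K)) := by rw [h1]
    rwa [← Matrix.mul_assoc, ← Matrix.mul_assoc, Matrix.nonsing_inv_mul _ hu, Matrix.one_mul,
      Matrix.one_mul, Subtype.coe_inj] at h2
  obtain ⟨s, hs⟩ := (LinearMap.injective_iff_surjective.1 hf) 1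
  have hs' : A * (s : Matrix ι ι K) = 1 := congrArg Subtype.val hs
  have hinv : A⁻¹ = s := by
    rw [← Matrix.mul_one A⁻¹, ← hs', ← Matrix.mul_assoc, Matrix.nonsing_inv_mul _ hu, Matrix.one_mul]
  rw [hinv]
  exact s.2

/-- If `q` commutes with `M` and `q` is invertible then `q⁻¹` commutes with `M`. [folklore] -/
private theorem nonsing_inv_mul_comm_of_comm {q M : Matrix ι ι K} (hq : IsUnit q.det) (h : q * M = M * q) :
    q⁻¹ * M = M * q⁻¹ := by
  calc q⁻¹ * M = q⁻¹ * M * (q * q⁻¹) := by rw [Matrix.mul_nonsing_inv _ hq, Matrix.mul_one]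
    _ = q⁻¹ * (M * q) * q⁻¹ := by simp only [Matrix.mul_assoc]
    _ = q⁻¹ * (q * M) * q⁻¹ := by rw [h]
    _ = M * q⁻¹ := by rw [← Matrix.mul_assoc, Matrix.nonsing_inv_mul _ hq, Matrix.one_mul]

end MatrixAlgebra

/-! ## §1 The constructive rank-one model: `ξ`, `a = R_ξ`, `a² = ξ²` -/

section RationalCore

variable {ι : Type*} [Fintype ι] [DecidableEq ι]

/-- `Λ_ℚ ≅ F` for a skew field `F ⊆ M_ι(ℚ)` with `dim_ℚ F = |ι|`: the orbit map `A ↦ A v` of a non-zero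
vector is a linear isomorphism. (As in `ComplexTorusAlbertTypeIIIShimura` §1, where it is private.)
[folklore] -/
private theorem exists_linearEquiv_mulVec_of_div (F : Subalgebra ℚ (Matrix ι ι ℚ))
    (hdiv : ∀ A ∈ F, A ≠ 0 → IsUnit A) (hdim : finrank ℚ F = Fintype.card ι) {v : ι → ℚ}
    (hv : v ≠ 0) : ∃ θ : F ≃ₗ[ℚ] (ι → ℚ), ∀ A : F, θ A = (A : Matrix ι ι ℚ) *ᵥ v := by
  let f : F →ₗ[ℚ] (ι → ℚ) :=
    { toFun := fun A ↦ (A : Matrix ι ι ℚ) *ᵥ v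
      map_add' := fun A B ↦ by simp only [Subalgebra.coe_add, Matrix.add_mulVec]
      map_smul' := fun c A ↦ by simp only [Subalgebra.coe_smul, Matrix.smul_mulVec, RingHom.id_apply] }
  have hf : Function.Injective f := by
    intro A B hAB
    by_contra hne
    have hne' : (A : Matrix ι ι ℚ) - (B : Matrix ι ι ℚ) ≠ 0 :=
      fun h ↦ hne (Subtype.ext (sub_eq_zero.1 h))
    have hu : IsUnit ((A : Matrix ι ι ℚ) - (B : Matrix ι ι ℚ)) := hdiv _ (F.sub_mem A.2 B.2) hne'
    have hinj := Matrix.mulVec_injective_iff_isUnit.2 hu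
    have h0 : ((A : Matrix ι ι ℚ) - (B : Matrix ι ι ℚ)) *ᵥ v =
        ((A : Matrix ι ι ℚ) - (B : Matrix ι ι ℚ)) *ᵥ 0 := by
      rw [Matrix.mulVec_zero, Matrix.sub_mulVec]
      exact sub_eq_zero.2 hAB
    exact hv (hinj h0)
  have hdim' : finrank ℚ F = finrank ℚ (ι → ℚ) := by rw [hdim, Module.finrank_fintype_fun_eq_card]
  exact ⟨f.linearEquivOfInjective hf hdim', fun A ↦ rfl⟩

/-- Non-degeneracy of the trace pairing `(Y, B) ↦ Tr(Y B)` on a `†`-stable `F` with `Tr(A†A) > 0`.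
[folklore] -/
private theorem eq_zero_of_forall_trace_mul_eq_zero_of_pos (F : Subalgebra ℚ (Matrix ι ι ℚ))
    {G : Matrix ι ι ℚ} (hFr : ∀ A ∈ F, rosati G A ∈ F)
    (hpos : ∀ A ∈ F, A ≠ 0 → 0 < (rosati G A * A).trace)
    {Y : Matrix ι ι ℚ} (hY : Y ∈ F) (h : ∀ B ∈ F, (Y * B).trace = 0) : Y = 0 := by
  by_contra hY0
  have h1 := hpos Y hY hY0
  rw [Matrix.trace_mul_comm, h _ (hFr Y hY)] at h1
  exact lt_irrefl _ h1

/-- Riesz representation for the trace pairing on `F`: every linear functional on `F` is `B ↦ Tr(ξ B)`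
for some `ξ ∈ F`. [folklore] -/
private theorem exists_eq_trace_mul_of_pos (F : Subalgebra ℚ (Matrix ι ι ℚ)) {G : Matrix ι ι ℚ}
    (hFr : ∀ A ∈ F, rosati G A ∈ F) (hpos : ∀ A ∈ F, A ≠ 0 → 0 < (rosati G A * A).trace)
    (φ : Module.Dual ℚ F) : ∃ ξ : F, ∀ B : F, φ B = ((ξ : Matrix ι ι ℚ) * B).trace := by
  let Ψ : F →ₗ[ℚ] Module.Dual ℚ F := LinearMap.mk₂ ℚ
    (fun Y B ↦ ((Y : Matrix ι ι ℚ) * B).trace)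
    (fun Y Y' B ↦ by simp only [Subalgebra.coe_add, Matrix.add_mul, Matrix.trace_add])
    (fun c Y B ↦ by simp only [Subalgebra.coe_smul, Matrix.smul_mul, Matrix.trace_smul, smul_eq_mul])
    (fun Y B B' ↦ by simp only [Subalgebra.coe_add, Matrix.mul_add, Matrix.trace_add])
    (fun c Y B ↦ by simp only [Subalgebra.coe_smul, Matrix.mul_smul, Matrix.trace_smul, smul_eq_mul])
  have hΨ : Function.Injective Ψ := by
    intro Y Y' hYY'
    have h0 : ∀ B ∈ F, (((Y : Matrix ι ι ℚ) - Y') * B).trace = 0 := by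
      intro B hB
      have := congrArg (fun ψ : Module.Dual ℚ F ↦ ψ ⟨B, hB⟩) hYY'
      simp only [Ψ, LinearMap.mk₂_apply] at this
      rw [Matrix.sub_mul, Matrix.trace_sub, this, sub_self]
    exact Subtype.ext (sub_eq_zero.1
      (eq_zero_of_forall_trace_mul_eq_zero_of_pos F hFr hpos (F.sub_mem Y.2 Y'.2) h0))
  have hsurj : Function.Surjective Ψ :=
    (LinearMap.injective_iff_surjective_of_finrank_eq_finrank (Subspace.dual_finrank_eq).symm).1 hΨ
  obtain ⟨ξ, hξ⟩ := hsurj φ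
  exact ⟨ξ, fun B ↦ by rw [← hξ]; rfl⟩

/-- Two matrices agreeing on the image of a surjection onto `ℚ^ι` are equal. [folklore] -/
private theorem eq_of_forall_mulVec_apply_eq' {F : Type*} (θ : F → (ι → ℚ)) (hθ : Function.Surjective θ)
    {M N : Matrix ι ι ℚ} (h : ∀ A, M *ᵥ θ A = N *ᵥ θ A) : M = N :=
  Matrix.ext_of_mulVec_single fun i ↦ by
    obtain ⟨A, hA⟩ := hθ (Pi.single i 1)
    rw [← hA, h]

omit [DecidableEq ι] in
/-- The alternating form `(x, y) ↦ ᵗx G y` is skew. [folklore] -/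
private theorem dotProduct_mulVec_skew' {G : Matrix ι ι ℚ} (hGt : Gᵀ = -G) (x y : ι → ℚ) :
    y ⬝ᵥ G *ᵥ x = -(x ⬝ᵥ G *ᵥ y) := by
  rw [Matrix.dotProduct_mulVec, dotProduct_comm, ← Matrix.mulVec_transpose, hGt, Matrix.neg_mulVec,
    dotProduct_neg]

/-- `X = Y` from `X - Y = U - V` and `U = V`. [folklore] -/
private theorem eq_of_sub_eq_sub' {R : Type*} [Ring R] {X Y U V : R} (h : X - Y = U - V) (hUV : U = V) :
    X = Y := by
  rw [hUV, sub_self] at h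
  exact sub_eq_zero.1 h

/-- **The constructive rank-one model** (the engine of `ComplexTorusAlbertTypeIIIShimura` §1, re-run with
its internal objects exported).  Let `F ⊆ M_ι(ℚ)` be a `ℚ`-subalgebra which is a skew field of dimension
`|ι|`, `G` an invertible alternating matrix whose adjoint anti-involution `† = rosati G` preserves `F`, is
positive on `F` and satisfies `A + A† ∈ Z(F)` for `A ∈ F` (the shape of `x ↦ x̄` on a quaternion algebra).
Then there are a non-zero `†`-skew `ξ ∈ F` with `ξ²` central in `F`, and a non-zero `†`-skew `a` in the
commutant `C(F)` with **`a² = ξ²`**, commuting with every `†`-skew element of `C(F)`.  (Model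
`ℚ^ι = F·v`: the form is `(Av, Bv) ↦ Tr(ξ A†B)`, `a = R_ξ` is right multiplication by `ξ`, and
`R_ξ R_ξ = R_{ξ²} = L_{ξ²}` because `ξ²` is central.)
[cite: HulekLaface2019PicardNumbersAV, §5.1 Prop. 5.1, exceptional case (1) and its proof (arXiv p. 10)]
[cite: Lange2023AbelianVarietiesComplex, §2.4.1 Thm. 2.4.9 (positivity of the Rosati trace form)] -/
theorem exists_skew_sq_central_and_commutant [Nonempty ι] (F : Subalgebra ℚ (Matrix ι ι ℚ))
    {G : Matrix ι ι ℚ} (hGu : IsUnit G.det) (hGt : Gᵀ = -G) (hFr : ∀ A ∈ F, rosati G A ∈ F)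
    (hdiv : ∀ A ∈ F, A ≠ 0 → IsUnit A) (hpos : ∀ A ∈ F, A ≠ 0 → 0 < (rosati G A * A).trace)
    (hcen : ∀ A ∈ F, ∀ B ∈ F, (A + rosati G A) * B = B * (A + rosati G A))
    (hdim : finrank ℚ F = Fintype.card ι) :
    ∃ ξ ∈ F, ∃ a ∈ Subalgebra.centralizer ℚ (F : Set (Matrix ι ι ℚ)),
      ξ ≠ 0 ∧ rosati G ξ = -ξ ∧ (∀ B ∈ F, ξ * ξ * B = B * (ξ * ξ)) ∧
      a ≠ 0 ∧ rosati G a = -a ∧ a * a = ξ * ξ ∧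
      ∀ c ∈ Subalgebra.centralizer ℚ (F : Set (Matrix ι ι ℚ)), rosati G c = -c → c * a = a * c := by
  classical
  -- §a. The rank-one model `θ : F ≃ ℚ^ι`, `A ↦ A v`.
  obtain ⟨i₀⟩ := ‹Nonempty ι›
  set v : ι → ℚ := Pi.single i₀ (1 : ℚ) with hv_def
  have hv : v ≠ 0 := by
    intro h
    have h1 := congrFun h i₀
    rw [hv_def, Pi.single_eq_same, Pi.zero_apply] at h1
    exact one_ne_zero h1
  obtain ⟨θ, hθ⟩ := exists_linearEquiv_mulVec_of_div F hdiv hdim hv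
  have hθmul : ∀ (B : Matrix ι ι ℚ) (hB : B ∈ F) (A : F), B *ᵥ θ A = θ (⟨B, hB⟩ * A) := by
    intro B hB A
    rw [hθ, hθ, Matrix.mulVec_mulVec]
    rfl
  have hθmul' : ∀ B A : F, (B : Matrix ι ι ℚ) *ᵥ θ A = θ (B * A) := fun B A ↦ hθmul B B.2 A
  have hext : ∀ {M N : Matrix ι ι ℚ}, (∀ A : F, M *ᵥ θ A = N *ᵥ θ A) → M = N :=
    fun h ↦ eq_of_forall_mulVec_apply_eq' θ θ.surjective h
  -- §b. The functional `φ(B) = ᵗv G (B v)` and its Riesz representative `ξ`: `φ(B) = Tr(ξ B)`.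
  let φ : Module.Dual ℚ F :=
    { toFun := fun B ↦ v ⬝ᵥ G *ᵥ θ B
      map_add' := fun A B ↦ by simp only [map_add, Matrix.mulVec_add, dotProduct_add]
      map_smul' := fun c A ↦ by
        simp only [map_smul, Matrix.mulVec_smul, dotProduct_smul, smul_eq_mul, RingHom.id_apply] }
  obtain ⟨ξ, hξ⟩ := exists_eq_trace_mul_of_pos F hFr hpos φ
  have hform : ∀ A B : F,
      θ A ⬝ᵥ G *ᵥ θ B = ((ξ : Matrix ι ι ℚ) * (rosati G A * B)).trace := by
    intro A B
    have h1 : θ A ⬝ᵥ G *ᵥ θ B = φ (⟨rosati G A, hFr _ A.2⟩ * B) := by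
      change _ = v ⬝ᵥ G *ᵥ θ (⟨rosati G A, hFr _ A.2⟩ * B)
      rw [← hθmul (rosati G (A : Matrix ι ι ℚ)) (hFr _ A.2) B, hθ A]
      exact dotProduct_mulVec_rosati hGu _ _ _
    rw [h1, hξ]
    rfl
  -- §c. `ξ† = -ξ`.
  have hξskew : rosati G (ξ : Matrix ι ι ℚ) = -(ξ : Matrix ι ι ℚ) := by
    have key : ∀ B : F, ((ξ : Matrix ι ι ℚ) * rosati G B).trace = -((ξ : Matrix ι ι ℚ) * B).trace := by
      intro B
      have h1 := hform B 1
      have h2 := hform 1 B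
      rw [Subalgebra.coe_one, Matrix.mul_one] at h1
      rw [Subalgebra.coe_one, rosati_one hGu, Matrix.one_mul] at h2
      rw [← h1, ← h2]
      exact dotProduct_mulVec_skew' hGt _ _
    have h0 : ∀ B ∈ F, (((ξ : Matrix ι ι ℚ) + rosati G ξ) * B).trace = 0 := by
      intro B hB
      have h3 : ((ξ : Matrix ι ι ℚ) * rosati G B).trace = (rosati G (ξ : Matrix ι ι ℚ) * B).trace := by
        rw [← trace_rosati hGu ((ξ : Matrix ι ι ℚ) * rosati G B), rosati_mul hGu, rosati_rosati hGu hGt,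
          Matrix.trace_mul_comm]
      rw [Matrix.add_mul, Matrix.trace_add, ← h3, key ⟨B, hB⟩]
      exact add_neg_cancel _
    have := eq_zero_of_forall_trace_mul_eq_zero_of_pos F hFr hpos (F.add_mem ξ.2 (hFr _ ξ.2)) h0
    exact eq_neg_of_add_eq_zero_right this
  -- §d. `ξ ≠ 0` (the form is non-degenerate and `v ≠ 0`).
  have hξ0 : (ξ : Matrix ι ι ℚ) ≠ 0 := by
    intro h0
    have h1 : φ (θ.symm (G⁻¹ *ᵥ v)) = 0 := by rw [hξ, h0, Matrix.zero_mul, Matrix.trace_zero]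
    have h2 : φ (θ.symm (G⁻¹ *ᵥ v)) = v ⬝ᵥ v := by
      change v ⬝ᵥ G *ᵥ θ (θ.symm (G⁻¹ *ᵥ v)) = _
      rw [LinearEquiv.apply_symm_apply, Matrix.mulVec_mulVec, Matrix.mul_nonsing_inv _ hGu,
        Matrix.one_mulVec]
    exact hv (dotProduct_self_eq_zero.1 (h2.symm.trans h1))
  have hξu : IsUnit (ξ : Matrix ι ι ℚ) := hdiv _ ξ.2 hξ0
  -- §e. `q = ξ²` is central in `F` and invertible.
  have hqcen : ∀ B ∈ F, (ξ : Matrix ι ι ℚ) * ξ * B = B * ((ξ : Matrix ι ι ℚ) * ξ) := by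
    intro B hB
    have h1 := hcen _ (F.mul_mem ξ.2 ξ.2) B hB
    rw [rosati_mul hGu, hξskew, neg_mul_neg, ← two_smul ℚ, Matrix.smul_mul, Matrix.mul_smul] at h1
    exact smul_right_injective (Matrix ι ι ℚ) (two_ne_zero) h1
  have hqu : IsUnit ((ξ : Matrix ι ι ℚ) * ξ) := hξu.mul hξu
  -- §f. Right multiplications `R ζ` (transported through `θ`): `R ζ (θ A) = θ (A ζ)`; they exhaust `C`.
  let R : F → Matrix ι ι ℚ := fun ζ ↦
    LinearMap.toMatrix' (θ.toLinearMap ∘ₗ LinearMap.mulRight ℚ ζ ∘ₗ θ.symm.toLinearMap)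
  have hR : ∀ ζ A : F, R ζ *ᵥ θ A = θ (A * ζ) := by
    intro ζ A
    simp only [R, LinearMap.toMatrix'_mulVec, LinearMap.coe_comp, LinearEquiv.coe_coe,
      Function.comp_apply, LinearEquiv.symm_apply_apply, LinearMap.mulRight_apply]
  have hRmem : ∀ ζ : F, R ζ ∈ Subalgebra.centralizer ℚ (F : Set (Matrix ι ι ℚ)) := by
    intro ζ
    rw [Subalgebra.mem_centralizer_iff]
    intro B hB
    refine hext fun A ↦ ?_
    rw [← Matrix.mulVec_mulVec, hR, hθmul B hB, ← Matrix.mulVec_mulVec, hθmul B hB, hR, mul_assoc]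
  have hRsurj : ∀ c ∈ Subalgebra.centralizer ℚ (F : Set (Matrix ι ι ℚ)), c = R (θ.symm (c *ᵥ v)) := by
    intro c hc
    rw [Subalgebra.mem_centralizer_iff] at hc
    refine hext fun A ↦ ?_
    rw [hR, ← hθmul' A, LinearEquiv.apply_symm_apply, Matrix.mulVec_mulVec, hc _ A.2,
      ← Matrix.mulVec_mulVec, ← hθ]
  -- §g. A `†`-skew `R ζ` satisfies `ξ ζ† = -ζ ξ`.
  have hskewrel : ∀ ζ : F, rosati G (R ζ) = -R ζ →
      (ξ : Matrix ι ι ℚ) * rosati G ζ = -((ζ : Matrix ι ι ℚ) * ξ) := by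
    intro ζ hζ
    have key : ∀ B : F, ((ξ : Matrix ι ι ℚ) * (rosati G ζ * B)).trace =
        -((ξ : Matrix ι ι ℚ) * (B * ζ)).trace := by
      intro B
      have h1 : R ζ *ᵥ θ 1 ⬝ᵥ G *ᵥ θ B = θ 1 ⬝ᵥ G *ᵥ (rosati G (R ζ) *ᵥ θ B) :=
        dotProduct_mulVec_rosati hGu _ _ _
      rw [hζ, Matrix.neg_mulVec, Matrix.mulVec_neg, dotProduct_neg, hR, hR, one_mul, hform, hform,
        Subalgebra.coe_one, rosati_one hGu, Matrix.one_mul] at h1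
      rw [h1]
      rfl
    have h0 : ∀ B ∈ F, (((ξ : Matrix ι ι ℚ) * rosati G ζ + ζ * ξ) * B).trace = 0 := by
      intro B hB
      have h2 := key ⟨B, hB⟩
      simp only at h2
      rw [Matrix.add_mul, Matrix.trace_add, Matrix.mul_assoc, h2, Matrix.mul_assoc,
        Matrix.trace_mul_cycle' (ξ : Matrix ι ι ℚ) B ζ, ← Matrix.mul_assoc, neg_add_cancel]
    have hmem : (ξ : Matrix ι ι ℚ) * rosati G ζ + ζ * ξ ∈ F :=
      F.add_mem (F.mul_mem ξ.2 (hFr _ ζ.2)) (F.mul_mem ζ.2 ξ.2)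
    exact eq_neg_of_add_eq_zero_left (eq_zero_of_forall_trace_mul_eq_zero_of_pos F hFr hpos hmem h0)
  -- §h. The algebra: `ξ ζ† = -ζ ξ`, `ζ† = t - ζ` with `t` central, `ξ² = q` central invertible ⟹ `[ζ, ξ] = 0`.
  have hcomm_of_skew : ∀ ζ : F, rosati G (R ζ) = -R ζ →
      (ζ : Matrix ι ι ℚ) * ξ = (ξ : Matrix ι ι ℚ) * ζ := by
    intro ζ hζ
    have h1 := hskewrel ζ hζ
    set ξm : Matrix ι ι ℚ := (ξ : Matrix ι ι ℚ) with hξm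
    set ζm : Matrix ι ι ℚ := (ζ : Matrix ι ι ℚ) with hζm
    set t : Matrix ι ι ℚ := ζm + rosati G ζm with ht_def
    have htξ : t * ξm = ξm * t := hcen _ ζ.2 _ ξ.2
    have hqζ : ξm * ξm * ζm = ζm * (ξm * ξm) := hqcen _ ζ.2
    have hd : ζm * ξm - ξm * ζm = -(t * ξm) := by
      have h2 : rosati G ζm = t - ζm := by rw [ht_def, add_sub_cancel_left]
      rw [h2, Matrix.mul_sub] at h1
      refine eq_of_sub_eq_sub' ?_ h1
      rw [htξ]
      noncomm_ring
    have hsum1 : ξm * (ζm * ξm - ξm * ζm) + (ζm * ξm - ξm * ζm) * ξm = 0 := by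
      refine eq_of_sub_eq_sub' ?_ hqζ.symm
      noncomm_ring
    have hsum2 : ξm * (ζm * ξm - ξm * ζm) + (ζm * ξm - ξm * ζm) * ξm =
        -((2 : ℚ) • (t * (ξm * ξm))) := by
      have e : ξm * -(t * ξm) + -(t * ξm) * ξm = -(ξm * t * ξm + t * (ξm * ξm)) := by noncomm_ring
      rw [hd, e, ← htξ, Matrix.mul_assoc, two_smul]
    have htq : t * (ξm * ξm) = 0 := by
      have h3 : (2 : ℚ) • (t * (ξm * ξm)) = 0 := by
        rw [← neg_eq_zero, ← hsum2, hsum1]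
      exact (smul_eq_zero.1 h3).resolve_left two_ne_zero
    have ht0 : t = 0 := (hqu.mul_left_eq_zero).1 htq
    rw [ht0, zero_mul, neg_zero, sub_eq_zero] at hd
    exact hd
  -- §i. Conclusion with `a = R ξ`.
  refine ⟨ξ, ξ.2, R ξ, hRmem ξ, hξ0, hξskew, hqcen, ?_, ?_, ?_, ?_⟩
  · -- `a ≠ 0`: `a (θ 1) = θ ξ ≠ 0`
    intro h0
    have h1 : θ (1 * ξ) = 0 := by rw [← hR, h0, Matrix.zero_mulVec]
    rw [one_mul, LinearEquiv.map_eq_zero_iff] at h1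
    exact hξ0 (by rw [h1]; rfl)
  · -- `a† = -a`
    rw [rosati_eq_iff hGu, ← forall_dotProduct_mulVec_eq_iff_transpose_mul_eq]
    intro x y
    obtain ⟨A, rfl⟩ := θ.surjective x
    obtain ⟨B, rfl⟩ := θ.surjective y
    rw [Matrix.neg_mulVec, hR, hR, ← map_neg θ, hform, hform, Subalgebra.coe_mul, rosati_mul hGu,
      hξskew, Subalgebra.coe_neg, Subalgebra.coe_mul]
    have e1 : (ξ : Matrix ι ι ℚ) * (-(ξ : Matrix ι ι ℚ) * rosati G A * B) =
        -((ξ : Matrix ι ι ℚ) * ξ * (rosati G A * B)) := by noncomm_ring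
    have e2 : (ξ : Matrix ι ι ℚ) * (rosati G A * -((B : Matrix ι ι ℚ) * ξ)) =
        -((ξ : Matrix ι ι ℚ) * (rosati G A * B) * ξ) := by noncomm_ring
    rw [e1, e2, Matrix.trace_neg, Matrix.trace_neg,
      Matrix.trace_mul_comm ((ξ : Matrix ι ι ℚ) * (rosati G (A : Matrix ι ι ℚ) * (B : Matrix ι ι ℚ)))
        (ξ : Matrix ι ι ℚ)]
    simp only [Matrix.mul_assoc]
  · -- `a a = ξ ξ`: `R_ξ R_ξ (θ A) = θ (A ξ ξ) = θ (ξ ξ A) = (ξ ξ) (θ A)`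
    refine hext fun A ↦ ?_
    rw [← Matrix.mulVec_mulVec, hR, hR, hθmul ((ξ : Matrix ι ι ℚ) * ξ) (F.mul_mem ξ.2 ξ.2) A]
    congr 1
    refine Subtype.ext ?_
    simp only [Subalgebra.coe_mul]
    rw [hqcen _ A.2, Matrix.mul_assoc]
  · -- every skew `c ∈ C` commutes with `a`
    intro c hc hcskew
    set ζ : F := θ.symm (c *ᵥ v) with hζ_def
    have hcR : c = R ζ := hRsurj c hc
    rw [hcR] at hcskew ⊢
    have hζξ := hcomm_of_skew ζ hcskew
    refine hext fun A ↦ ?_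
    rw [← Matrix.mulVec_mulVec, hR, hR, ← Matrix.mulVec_mulVec, hR, hR, mul_assoc, mul_assoc]
    congr 2
    exact Subtype.ext hζξ.symm

end RationalCore

/-! ## §2 Matrix algebra of the exceptional case: the anticommuting partner `j` and the involution
`T = ξ a (ξ²)⁻¹` -/

section Involution

variable {ι : Type*} [Fintype ι] [DecidableEq ι]

/-- **An anticommuting partner.** In a subalgebra `F`, if `ξ ∈ F` is invertible with `ξ²` central in
`F` but `ξ` itself not central (`ξ y ≠ y ξ` for some `y ∈ F`), then `j = ξ y ξ - ξ² y ∈ F` is non-zero and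
anticommutes with `ξ`: `j ξ = -ξ j` (the `-1`-eigenvector of the inner involution `x ↦ ξ x ξ⁻¹`; for a
quaternion algebra `F = K(ξ) ⊕ K(ξ) j`). [folklore] -/
private theorem exists_mem_anticommute (F : Subalgebra ℚ (Matrix ι ι ℚ)) {ξ y : Matrix ι ι ℚ} (hξ : ξ ∈ F)
    (hξu : IsUnit ξ.det) (hq : ∀ B ∈ F, ξ * ξ * B = B * (ξ * ξ)) (hy : y ∈ F) (hyξ : ξ * y ≠ y * ξ) :
    ∃ j ∈ F, j ≠ 0 ∧ j * ξ = -(ξ * j) := by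
  refine ⟨ξ * y * ξ - ξ * ξ * y, F.sub_mem (F.mul_mem (F.mul_mem hξ hy) hξ) (F.mul_mem (F.mul_mem hξ hξ) hy),
    ?_, ?_⟩
  · intro h0
    have h1 : ξ * (y * ξ - ξ * y) = 0 := by rw [Matrix.mul_sub, ← Matrix.mul_assoc, ← Matrix.mul_assoc, h0]
    have h2 : y * ξ - ξ * y = 0 := by
      have := congrArg (fun M ↦ ξ⁻¹ * M) h1
      simpa only [← Matrix.mul_assoc, Matrix.nonsing_inv_mul _ hξu, Matrix.one_mul, Matrix.mul_zero] using this
    exact hyξ (sub_eq_zero.1 h2).symm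
  · -- `j ξ = ξ y ξ² - ξ² y ξ = ξ² (ξ y) - ξ² (y ξ)` and `ξ j = ξ² y ξ - ξ³ y = ξ² (y ξ) - ξ² (ξ y)`
    have h1 : ξ * y * (ξ * ξ) = ξ * ξ * (ξ * y) := (hq _ (F.mul_mem hξ hy)).symm
    rw [Matrix.sub_mul, Matrix.mul_sub, Matrix.mul_assoc (ξ * y) ξ ξ, h1]
    noncomm_ring

/-- **`T = ξ a (ξ²)⁻¹` is an involution** when `a` commutes with `ξ` and `a² = ξ²` (`ξ` invertible):
`T² = ξ² a² (ξ²)⁻² = 1`. [folklore] -/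
private theorem involution_mul_self_eq_one {ξ a : Matrix ι ι ℚ} (hξu : IsUnit ξ.det) (haξ : a * ξ = ξ * a)
    (haa : a * a = ξ * ξ) :
    ξ * a * (ξ * ξ)⁻¹ * (ξ * a * (ξ * ξ)⁻¹) = 1 := by
  have hqu : IsUnit (ξ * ξ).det := by rw [Matrix.det_mul]; exact hξu.mul hξu
  have hqa : ξ * ξ * a = a * (ξ * ξ) := by rw [Matrix.mul_assoc, ← haξ, ← Matrix.mul_assoc, ← haξ, Matrix.mul_assoc]
  have h1 : (ξ * ξ)⁻¹ * ξ = ξ * (ξ * ξ)⁻¹ := nonsing_inv_mul_comm_of_comm hqu (Matrix.mul_assoc ξ ξ ξ)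
  have h2 : (ξ * ξ)⁻¹ * a = a * (ξ * ξ)⁻¹ := nonsing_inv_mul_comm_of_comm hqu hqa
  calc ξ * a * (ξ * ξ)⁻¹ * (ξ * a * (ξ * ξ)⁻¹)
      = ξ * a * ((ξ * ξ)⁻¹ * ξ) * a * (ξ * ξ)⁻¹ := by simp only [Matrix.mul_assoc]
    _ = ξ * a * ξ * ((ξ * ξ)⁻¹ * a) * (ξ * ξ)⁻¹ := by rw [h1]; simp only [Matrix.mul_assoc]
    _ = ξ * (a * ξ) * a * (ξ * ξ)⁻¹ * (ξ * ξ)⁻¹ := by rw [h2]; simp only [Matrix.mul_assoc]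
    _ = ξ * ξ * (a * a) * (ξ * ξ)⁻¹ * (ξ * ξ)⁻¹ := by rw [haξ]; simp only [Matrix.mul_assoc]
    _ = 1 := by
      rw [haa, Matrix.mul_assoc (ξ * ξ) (ξ * ξ), Matrix.mul_nonsing_inv _ hqu, Matrix.mul_one,
        Matrix.mul_nonsing_inv _ hqu]

/-- **`j` anticommutes with `T = ξ a (ξ²)⁻¹`** when `j ξ = -ξ j` and `j a = a j`: `j T = -T j`. [folklore] -/
private theorem anticommute_involution {ξ a j : Matrix ι ι ℚ} (hξu : IsUnit ξ.det) (hjξ : j * ξ = -(ξ * j))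
    (hja : j * a = a * j) :
    j * (ξ * a * (ξ * ξ)⁻¹) = -(ξ * a * (ξ * ξ)⁻¹ * j) := by
  have hqu : IsUnit (ξ * ξ).det := by rw [Matrix.det_mul]; exact hξu.mul hξu
  have hjq : ξ * ξ * j = j * (ξ * ξ) := by
    rw [Matrix.mul_assoc, ← neg_neg (ξ * j), ← hjξ, Matrix.mul_neg, ← Matrix.mul_assoc, ← neg_mul, ← hjξ,
      Matrix.mul_assoc]
  have h3 : (ξ * ξ)⁻¹ * j = j * (ξ * ξ)⁻¹ := nonsing_inv_mul_comm_of_comm hqu hjq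
  calc j * (ξ * a * (ξ * ξ)⁻¹) = j * ξ * a * (ξ * ξ)⁻¹ := by simp only [Matrix.mul_assoc]
    _ = -(ξ * (j * a) * (ξ * ξ)⁻¹) := by rw [hjξ]; simp only [neg_mul, Matrix.mul_assoc]
    _ = -(ξ * a * (j * (ξ * ξ)⁻¹)) := by rw [hja]; simp only [Matrix.mul_assoc]
    _ = -(ξ * a * (ξ * ξ)⁻¹ * j) := by rw [← h3]; simp only [Matrix.mul_assoc]

/-- A matrix anticommuting with a non-zero matrix is not `1`. [folklore] -/
private theorem ne_one_of_anticommute {T j : Matrix ι ι ℚ} (hj0 : j ≠ 0) (h : j * T = -(T * j)) : T ≠ 1 := by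
  rintro rfl
  rw [Matrix.mul_one, Matrix.one_mul] at h
  exact hj0 ((smul_eq_zero.1 (show (2 : ℚ) • j = 0 by rw [two_smul]; nth_rw 1 [h]; exact neg_add_cancel j)).resolve_left
    two_ne_zero)

/-- A matrix anticommuting with a non-zero matrix is not `-1`. [folklore] -/
private theorem ne_neg_one_of_anticommute {T j : Matrix ι ι ℚ} (hj0 : j ≠ 0) (h : j * T = -(T * j)) : T ≠ -1 := by
  intro hT
  have h' : j * (-T) = -((-T) * j) := by rw [Matrix.mul_neg, h, neg_mul]
  exact ne_one_of_anticommute hj0 h' (by rw [hT, neg_neg])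

/-- **`Tr T = 0`** for a matrix anticommuting with an invertible one (`T = -j⁻¹ T j`). [folklore] -/
private theorem trace_eq_zero_of_anticommute {T j : Matrix ι ι ℚ} (hju : IsUnit j.det) (h : j * T = -(T * j)) :
    T.trace = 0 := by
  have h1 : T = -(j⁻¹ * T * j) := by
    rw [Matrix.mul_assoc, ← Matrix.mul_neg, ← h, ← Matrix.mul_assoc, Matrix.nonsing_inv_mul _ hju, Matrix.one_mul]
  have h2 : T.trace = -T.trace := by
    nth_rw 1 [h1]
    rw [Matrix.trace_neg, Matrix.trace_mul_cycle, Matrix.mul_nonsing_inv _ hju, Matrix.one_mul]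
  have h3 : (2 : ℚ) * T.trace = 0 := by rw [two_mul]; nth_rw 1 [h2]; exact neg_add_cancel _
  exact (mul_eq_zero.1 h3).resolve_left two_ne_zero

/-- `Tr ½(1 + T) · 2 = |ι|` when `Tr T = 0`. [folklore] -/
private theorem two_mul_trace_half_one_add {T : Matrix ι ι ℚ} (hT : T.trace = 0) :
    2 * ((1 / 2 : ℚ) • (1 + T)).trace = Fintype.card ι := by
  rw [Matrix.trace_smul, Matrix.trace_add, Matrix.trace_one, hT, add_zero, smul_eq_mul]
  ring

end Involution

/-! ## §3 At torus level: `a ∈ End_ℚ(X)`, the involution `T ∈ End_ℚ(X)`, the idempotent `P = ½(1 + T)`,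
and `X ∼ X^P × X^P` -/

section Torus

variable {κ : Type} [Fintype κ] [DecidableEq κ] [Nonempty κ] {E : Type*} [NormedAddCommGroup E]
  [NormedSpace ℂ E] {Ψ : (κ → ℝ) ≃L[ℝ] E} {η : E [⋀^Fin 2]→L[ℝ] ℝ} {G : Matrix κ κ ℚ}

/-- `2 x = 0 ⟹ x = 0` for a `†`-skew central element when `†` is the identity on it. [folklore] -/
private theorem eq_zero_of_rosati_eq_self_of_rosati_eq_neg {x : Matrix κ κ ℚ} (h₁ : rosati G x = x)
    (h₂ : rosati G x = -x) : x = 0 := by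
  have h : (2 : ℚ) • x = 0 := by
    rw [two_smul]
    nth_rw 1 [← h₁]
    rw [h₂, neg_add_cancel]
  exact (smul_eq_zero.1 h).resolve_left two_ne_zero

/-- **Step 1 (the data).** For a polarised complex torus `X = E/Ψ(ℤ^κ)` with rational Gram matrix `G`
(`† = rosati G` the Rosati involution) and a `†`-stable skew field `F ⊆ End_ℚ(X)` of `ℚ`-dimension
`rk Λ = |κ|` on which `†` is of the first kind with `A + A†` central (type III with `m = 1`): there are a
non-zero skew `ξ ∈ F`, NOT central in `F`, with `ξ²` central; a non-zero skew `a ∈ End_ℚ(X) ∩ C(F)` with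
`a² = ξ²`, `a ∉ F` (so `End_ℚ(X) ⊋ F`); and a non-zero `j ∈ F` with `j ξ = -ξ j`.  (`a ∈ End_ℚ(X)` is
p12's rational descent `mem_endAlgRat_of_forall_skew_centralizer_commute`: `a` commutes with the skew
part of `C(F) ⊇ C(End_ℚ(X))`, through which `J` descends.)
[cite: HulekLaface2019PicardNumbersAV, §5.1 Prop. 5.1, exceptional case (1) and its proof (arXiv p. 10)]
[cite: Lange2023AbelianVarietiesComplex, §2.6.2 Thm. 2.6.5 (c) (`x' = x̄` on type III) and §7.2.3 Prop. 7.2.6] -/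
theorem exists_skew_data_of_typeIII_sub (hη : IsRiemannForm Ψ η)
    (hG : G.map (Rat.cast : ℚ → ℝ) = latticeGram Ψ η) (F : Subalgebra ℚ (Matrix κ κ ℚ))
    (hF : F ≤ endAlgRat Ψ) (hFr : ∀ A ∈ F, rosati G A ∈ F) (hdiv : ∀ A ∈ F, A ≠ 0 → IsUnit A)
    (hcen : ∀ A ∈ F, ∀ B ∈ F, (A + rosati G A) * B = B * (A + rosati G A))
    (hfk : ∀ z ∈ F, (∀ B ∈ F, z * B = B * z) → rosati G z = z)
    (hdim : finrank ℚ F = Fintype.card κ) :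
    ∃ ξ ∈ F, ∃ a ∈ endAlgRat Ψ, ∃ j ∈ F,
      ξ ≠ 0 ∧ rosati G ξ = -ξ ∧ (∀ B ∈ F, ξ * ξ * B = B * (ξ * ξ)) ∧ (∃ y ∈ F, ξ * y ≠ y * ξ) ∧
      a ∈ Subalgebra.centralizer ℚ (F : Set (Matrix κ κ ℚ)) ∧ a ≠ 0 ∧ rosati G a = -a ∧
      a * a = ξ * ξ ∧ a ∉ F ∧ j ≠ 0 ∧ j * ξ = -(ξ * j) := by
  have hGu : IsUnit G.det := isUnit_det_of_map_ratCast hG hη.isUnit_det_latticeGram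
  have hGt : Gᵀ = -G := transpose_eq_neg_of_map_ratCast Ψ hG
  obtain ⟨ξ, hξF, a, haC, hξ0, hξskew, hqcen, ha0, haskew, haa, hcomm⟩ :=
    exists_skew_sq_central_and_commutant F hGu hGt hFr hdiv
      (fun A hA hA0 ↦ trace_rosati_mul_self_pos_rat Ψ hη.1 hη.2.2 hG (hF hA) hA0) hcen hdim
  -- `a ∈ End_ℚ(X)`: it commutes with the skew part of `C(End_ℚ(X)) ⊆ C(F)`.
  have haE : a ∈ endAlgRat Ψ :=
    mem_endAlgRat_of_forall_skew_centralizer_commute hη hG fun c hc hcs ↦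
      hcomm c (Subalgebra.centralizer_le ℚ (F : Set (Matrix κ κ ℚ)) (endAlgRat Ψ : Set (Matrix κ κ ℚ))
        (SetLike.coe_subset_coe.2 hF) hc) hcs
  -- `ξ` is not central (else `ξ† = ξ = -ξ`).
  have hξnc : ∃ y ∈ F, ξ * y ≠ y * ξ := by
    by_contra h
    refine hξ0 (eq_zero_of_rosati_eq_self_of_rosati_eq_neg (hfk ξ hξF fun B hB ↦ ?_) hξskew)
    by_contra hB'
    exact h ⟨B, hB, hB'⟩
  obtain ⟨y, hyF, hyξ⟩ := hξnc
  have hξu : IsUnit ξ.det := (Matrix.isUnit_iff_isUnit_det _).1 (hdiv ξ hξF hξ0)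
  obtain ⟨j, hjF, hj0, hjξ⟩ := exists_mem_anticommute F hξF hξu hqcen hyF hyξ
  -- `a ∉ F` (else central in `F`, hence `†`-fixed).
  have haF : a ∉ F := fun haF ↦ ha0 (eq_zero_of_rosati_eq_self_of_rosati_eq_neg
    (hfk a haF fun B hB ↦ ((Subalgebra.mem_centralizer_iff ℚ).1 haC B hB).symm) haskew)
  exact ⟨ξ, hξF, a, haE, j, hjF, hξ0, hξskew, hqcen, ⟨y, hyF, hyξ⟩, haC, ha0, haskew, haa, haF, hj0, hjξ⟩

omit [Nonempty κ] in
/-- **Step 2 (the involution).** With `ξ, a, j` as in Step 1, `T = ξ a (ξ²)⁻¹` lies in `End_ℚ(X)`, and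
`T² = 1`, `j T = -T j`, `Tr T = 0`, `T ≠ ±1`. [cite: HulekLaface2019PicardNumbersAV, §5.1 Prop. 5.1, exceptional case (1) (arXiv p. 10)] -/
theorem involution_mem_endAlgRat {F : Subalgebra ℚ (Matrix κ κ ℚ)} (hF : F ≤ endAlgRat Ψ)
    (hdiv : ∀ A ∈ F, A ≠ 0 → IsUnit A) {ξ a j : Matrix κ κ ℚ} (hξF : ξ ∈ F) (hξ0 : ξ ≠ 0)
    (haE : a ∈ endAlgRat Ψ) (haC : a ∈ Subalgebra.centralizer ℚ (F : Set (Matrix κ κ ℚ)))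
    (haa : a * a = ξ * ξ) (hjF : j ∈ F) (hj0 : j ≠ 0) (hjξ : j * ξ = -(ξ * j)) :
    ξ * a * (ξ * ξ)⁻¹ ∈ endAlgRat Ψ ∧
      ξ * a * (ξ * ξ)⁻¹ * (ξ * a * (ξ * ξ)⁻¹) = 1 ∧
      j * (ξ * a * (ξ * ξ)⁻¹) = -(ξ * a * (ξ * ξ)⁻¹ * j) ∧
      (ξ * a * (ξ * ξ)⁻¹).trace = 0 ∧ ξ * a * (ξ * ξ)⁻¹ ≠ 1 ∧ ξ * a * (ξ * ξ)⁻¹ ≠ -1 := by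
  have hξu : IsUnit ξ.det := (Matrix.isUnit_iff_isUnit_det _).1 (hdiv ξ hξF hξ0)
  have hju : IsUnit j.det := (Matrix.isUnit_iff_isUnit_det _).1 (hdiv j hjF hj0)
  have haξ : a * ξ = ξ * a := ((Subalgebra.mem_centralizer_iff ℚ).1 haC ξ hξF).symm
  have hja : j * a = a * j := (Subalgebra.mem_centralizer_iff ℚ).1 haC j hjF
  have hT : ξ * a * (ξ * ξ)⁻¹ ∈ endAlgRat Ψ :=
    (endAlgRat Ψ).mul_mem ((endAlgRat Ψ).mul_mem (hF hξF) haE)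
      (inv_mem_endAlgRat Ψ ((endAlgRat Ψ).mul_mem (hF hξF) (hF hξF)))
  have hjT := anticommute_involution hξu hjξ hja
  exact ⟨hT, involution_mul_self_eq_one hξu haξ haa, hjT, trace_eq_zero_of_anticommute hju hjT,
    ne_one_of_anticommute hj0 hjT, ne_neg_one_of_anticommute hj0 hjT⟩

omit [Nonempty κ] in
/-- **Step 3 (the idempotent).** For an involution `σ ∈ End_ℚ(X)` anticommuting with a unit `u` of
`End_ℚ(X)`, the idempotents `P = ½(1 + σ)` and `1 - P = ½(1 - σ)` are conjugate: `1 - P = u P u⁻¹`.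
[cite: LangeRecillas2004, §2 Prop. 2.1 (conjugate idempotents), p0004] -/
theorem one_sub_involutionIdempotent_eq_conj {σ : endAlgRat Ψ} (u : (endAlgRat Ψ)ˣ)
    (hu : ((u : endAlgRat Ψ) : Matrix κ κ ℚ) * (σ : Matrix κ κ ℚ) =
      -((σ : Matrix κ κ ℚ) * ((u : endAlgRat Ψ) : Matrix κ κ ℚ))) :
    1 - involutionIdempotent Ψ σ = ↑u * involutionIdempotent Ψ σ * ↑u⁻¹ := by
  have hinv : ((u : endAlgRat Ψ) : Matrix κ κ ℚ) * (((u⁻¹ : (endAlgRat Ψ)ˣ) : endAlgRat Ψ) : Matrix κ κ ℚ) = 1 := by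
    rw [← Subalgebra.coe_mul, Units.mul_inv, Subalgebra.coe_one]
  apply Subtype.ext
  have hL : ((1 - involutionIdempotent Ψ σ : endAlgRat Ψ) : Matrix κ κ ℚ) =
      (1 / 2 : ℚ) • (1 - (σ : Matrix κ κ ℚ)) := by
    rw [one_sub_involutionIdempotent, Subalgebra.coe_smul, Subalgebra.coe_sub, Subalgebra.coe_one]
  have hR : ((↑u * involutionIdempotent Ψ σ * ↑u⁻¹ : endAlgRat Ψ) : Matrix κ κ ℚ) =
      (1 / 2 : ℚ) • (1 - (σ : Matrix κ κ ℚ)) := by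
    rw [Subalgebra.coe_mul, Subalgebra.coe_mul, involutionIdempotent, Subalgebra.coe_smul,
      Subalgebra.coe_add, Subalgebra.coe_one, Matrix.mul_smul, Matrix.smul_mul, Matrix.mul_add,
      Matrix.mul_one, Matrix.add_mul, hinv, hu, Matrix.neg_mul, Matrix.mul_assoc, hinv, Matrix.mul_one,
      sub_eq_add_neg]
  rw [hL, hR]

/-- **Step 4 (the square).** For an involution `σ ∈ End_ℚ(X)` (`σ² = 1`) anticommuting with a unit `u`
of `End_ℚ(X)`, the idempotent `P = ½(1 + σ)` is neither `0` nor `1`, **`X ∼ X^P × X^P`** — from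
`X ∼ X^P × X^{1-P}` (`isIsogeny_sum_involution`) and `X^{1-P} = X^{uPu⁻¹} ∼ X^P`
(`isIsogenous_idemPeriod_conj_of_unit`) — and **`rk Λ(X^P) = Tr P = ½ rk Λ`** (`Tr σ = 0`).
[cite: LangeRecillas2004, §1 Prop. 1.1 (b) and §2 Prop. 2.1 (the case `G = ℤ/2ℤ`, conjugate idempotents), p0002–p0004]
[cite: Lange2023AbelianVarietiesComplex, §2.4.4 Cor. 2.4.28 (`dim X^ε = Tr(ε)`), p0124] -/
theorem involutionIdempotent_square (σ : endAlgRat Ψ) (hσσ : σ * σ = 1) (u : (endAlgRat Ψ)ˣ)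
    (hu : ((u : endAlgRat Ψ) : Matrix κ κ ℚ) * (σ : Matrix κ κ ℚ) =
      -((σ : Matrix κ κ ℚ) * ((u : endAlgRat Ψ) : Matrix κ κ ℚ))) :
    IsIdempotentElem (involutionIdempotent Ψ σ) ∧ involutionIdempotent Ψ σ ≠ 0 ∧
      involutionIdempotent Ψ σ ≠ 1 ∧
      IsIsogenous Ψ (powPeriod (idemPeriod Ψ (involutionIdempotent Ψ σ)) 2) ∧
      2 * subRank (idemSubspace ((involutionIdempotent Ψ σ : endAlgRat Ψ) : Matrix κ κ ℚ)) =
        Fintype.card κ := by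
  set T : Matrix κ κ ℚ := (σ : Matrix κ κ ℚ) with hT_def
  set P : endAlgRat Ψ := involutionIdempotent Ψ σ with hP_def
  have hPi : IsIdempotentElem P := isIdempotentElem_involutionIdempotent Ψ hσσ
  have hju : IsUnit ((u : endAlgRat Ψ) : Matrix κ κ ℚ).det :=
    (Matrix.isUnit_iff_isUnit_det _).1 ((isUnit_endAlgRat_iff Ψ (u : endAlgRat Ψ)).1 u.isUnit)
  have hj0 : ((u : endAlgRat Ψ) : Matrix κ κ ℚ) ≠ 0 := by
    intro h0
    rw [h0, Matrix.det_zero] at hju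
    exact not_isUnit_zero hju
  have htr : T.trace = 0 := trace_eq_zero_of_anticommute hju hu
  have hT1 : T ≠ 1 := ne_one_of_anticommute hj0 hu
  have hT1' : T ≠ -1 := ne_neg_one_of_anticommute hj0 hu
  have hconj : 1 - P = ↑u * P * ↑u⁻¹ := one_sub_involutionIdempotent_eq_conj u hu
  have hcoe : ((P : endAlgRat Ψ) : Matrix κ κ ℚ) = (1 / 2 : ℚ) • (1 + T) := by
    rw [hP_def, involutionIdempotent, Subalgebra.coe_smul, Subalgebra.coe_add, Subalgebra.coe_one]
  refine ⟨hPi, ?_, ?_, ?_, ?_⟩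
  · -- `P ≠ 0` since `T ≠ -1`
    intro hP0
    apply hT1'
    have h1 := hcoe
    rw [hP0, Subalgebra.coe_zero] at h1
    have h2 : (1 : Matrix κ κ ℚ) + T = 0 := by
      have := congrArg (fun M : Matrix κ κ ℚ ↦ (2 : ℚ) • M) h1
      simpa only [smul_zero, smul_smul, show (2 : ℚ) * (1 / 2) = 1 by norm_num, one_smul] using this.symm
    exact eq_neg_of_add_eq_zero_right h2
  · -- `P ≠ 1` since `T ≠ 1`
    intro hP1
    apply hT1
    have h1 : ((1 - P : endAlgRat Ψ) : Matrix κ κ ℚ) = (1 / 2 : ℚ) • (1 - T) := by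
      rw [hP_def, one_sub_involutionIdempotent, Subalgebra.coe_smul, Subalgebra.coe_sub, Subalgebra.coe_one]
    rw [hP1, sub_self, Subalgebra.coe_zero] at h1
    have h2 : (1 : Matrix κ κ ℚ) - T = 0 := by
      have := congrArg (fun M : Matrix κ κ ℚ ↦ (2 : ℚ) • M) h1
      simpa only [smul_zero, smul_smul, show (2 : ℚ) * (1 / 2) = 1 by norm_num, one_smul] using this.symm
    exact (sub_eq_zero.1 h2).symm
  · -- `X ∼ X^P × X^{1-P} ∼ (X^P)²`
    have h1 : IsIsogenous (sigmaPiPeriod fun i ↦ idemPeriod Ψ (![P, 1 - P] i)) Ψ :=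
      ⟨_, isIsogeny_sum_involution Ψ hσσ⟩
    have h2 : IsIsogenous (sigmaPiPeriod fun i ↦ idemPeriod Ψ (![P, 1 - P] i))
        (powPeriod (idemPeriod Ψ P) 2) := by
      refine IsIsogenous.sigmaPi_powPeriod (fun i ↦ idemPeriod Ψ (![P, 1 - P] i)) (idemPeriod Ψ P)
        fun i ↦ ?_
      fin_cases i
      · exact IsIsogenous.refl _
      · change IsIsogenous (idemPeriod Ψ (1 - P)) (idemPeriod Ψ P)
        rw [hconj]
        exact isIsogenous_idemPeriod_conj_of_unit Ψ P u
    exact IsIsogenous.trans _ _ _ (IsIsogenous.symm _ _ h1) h2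
  · -- `rk Λ(X^P) = Tr P = ½ |κ|`
    have hPP : (P : Matrix κ κ ℚ) * (P : Matrix κ κ ℚ) = P := congrArg Subtype.val hPi.eq
    have h1 := trace_eq_finrank_idemSubspace hPP
    rw [finrank_eq_subRank (isLatticeSubspace_idemSubspace _)] at h1
    have h2 : 2 * (P : Matrix κ κ ℚ).trace = Fintype.card κ := by
      rw [hcoe]
      exact two_mul_trace_half_one_add htr
    have h3 : (2 : ℝ) * (subRank (idemSubspace (P : Matrix κ κ ℚ)) : ℝ) = (Fintype.card κ : ℝ) := by
      rw [← h1, ← Rat.cast_natCast (Fintype.card κ), ← h2, Rat.cast_mul, Rat.cast_ofNat]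
    exact_mod_cast h3

/-- **Hulek–Laface Prop. 5.1, exceptional case (1), as printed — "`X` is isogenous to a square `Y²`,
where `Y` is an abelian variety of dimension `e`" — in the "contains" form, every dimension.**  Let
`X = E/Ψ(ℤ^κ)` be a polarised complex torus (`η` a Riemann form with rational Gram matrix `G`,
`† = rosati G` its Rosati involution, `|κ| = rk Λ = 2 dim X`) and `F ⊆ End_ℚ(X)` a `†`-stable
`ℚ`-subalgebra which is a skew field of `ℚ`-dimension `rk Λ` (i.e. `m := 2 dim X/[F:ℚ] = 1`) such that
`†|_F` is of the first kind (`z† = z` on the centre `Z(F)`) with `A + A† ∈ Z(F)` for all `A ∈ F` (by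
Lange Thm. 2.6.5 these are exactly the positive pairs `(F, †|_F)` of type III — `F` a totally definite
quaternion algebra over the totally real field `Z(F)`, `[F:ℚ] = 4e`, `†|_F = x̄` — together with the
commutative type I, for which the hypotheses are contradictory).  Then there is an idempotent
`0 ≠ P ≠ 1` of `End_ℚ(X)` with **`X ∼ X^P × X^P`** and **`rk Λ(X^P) = ½ rk Λ`** (`dim X^P = ½ dim X = e`).
Construction: `P = ½(1 + T)`, `T = ξ a (ξ²)⁻¹` (Steps 1–2, 4).  Declared deviation: Hulek–Laface cite
Shimura's analytic families [shimura63, §4] for this; the proof here is the elementary rational one above.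
[cite: HulekLaface2019PicardNumbersAV, §5.1 Prop. 5.1, exceptional case (1) and its proof: "`X` is isogenous to a square `Y²`, where `Y` is an abelian variety of dimension `e₀`" (arXiv p. 10)]
[cite: Shimura1963AnalyticFamilies, §4 (the exceptional case "type III, `m = 1`"; through Hulek–Laface)]
[cite: Lange2023AbelianVarietiesComplex, §2.6.1 table (type III: `[F:ℚ] = 4e`, `2e ∣ g`) and §2.6.2 Thm. 2.6.5 (c), PDF p0138, p0141] -/
theorem exists_isIsogenous_powPeriod_two_of_typeIII_sub (hη : IsRiemannForm Ψ η)
    (hG : G.map (Rat.cast : ℚ → ℝ) = latticeGram Ψ η) (F : Subalgebra ℚ (Matrix κ κ ℚ))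
    (hF : F ≤ endAlgRat Ψ) (hFr : ∀ A ∈ F, rosati G A ∈ F) (hdiv : ∀ A ∈ F, A ≠ 0 → IsUnit A)
    (hcen : ∀ A ∈ F, ∀ B ∈ F, (A + rosati G A) * B = B * (A + rosati G A))
    (hfk : ∀ z ∈ F, (∀ B ∈ F, z * B = B * z) → rosati G z = z)
    (hdim : finrank ℚ F = Fintype.card κ) :
    ∃ P : endAlgRat Ψ, IsIdempotentElem P ∧ P ≠ 0 ∧ P ≠ 1 ∧
      IsIsogenous Ψ (powPeriod (idemPeriod Ψ P) 2) ∧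
      2 * subRank (idemSubspace (P : Matrix κ κ ℚ)) = Fintype.card κ := by
  obtain ⟨ξ, hξF, a, haE, j, hjF, hξ0, -, -, -, haC, -, -, haa, -, hj0, hjξ⟩ :=
    exists_skew_data_of_typeIII_sub hη hG F hF hFr hdiv hcen hfk hdim
  obtain ⟨hT, hTT, hjT, -, -, -⟩ := involution_mem_endAlgRat hF hdiv hξF hξ0 haE haC haa hjF hj0 hjξ
  set σ : endAlgRat Ψ := ⟨ξ * a * (ξ * ξ)⁻¹, hT⟩ with hσ_def
  have hσσ : σ * σ = 1 := Subtype.ext hTT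
  obtain ⟨u, hu⟩ := (isUnit_endAlgRat_iff Ψ (⟨j, hF hjF⟩ : endAlgRat Ψ)).2 (hdiv j hjF hj0)
  have huσ : ((u : endAlgRat Ψ) : Matrix κ κ ℚ) * (σ : Matrix κ κ ℚ) =
      -((σ : Matrix κ κ ℚ) * ((u : endAlgRat Ψ) : Matrix κ κ ℚ)) := by
    rw [hu]
    exact hjT
  exact ⟨involutionIdempotent Ψ σ, involutionIdempotent_square σ hσσ u huσ⟩

/-- **`dim X^P = ½ dim X`** (`= e`, the degree of the centre of `F`) in complex dimensions.
[cite: HulekLaface2019PicardNumbersAV, §5.1 Prop. 5.1, exceptional case (1): "`Y` is an abelian variety of dimension `e₀`" (arXiv p. 10)] -/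
theorem exists_isIsogenous_powPeriod_two_finrank_of_typeIII_sub [FiniteDimensional ℂ E]
    (hη : IsRiemannForm Ψ η)
    (hG : G.map (Rat.cast : ℚ → ℝ) = latticeGram Ψ η) (F : Subalgebra ℚ (Matrix κ κ ℚ))
    (hF : F ≤ endAlgRat Ψ) (hFr : ∀ A ∈ F, rosati G A ∈ F) (hdiv : ∀ A ∈ F, A ≠ 0 → IsUnit A)
    (hcen : ∀ A ∈ F, ∀ B ∈ F, (A + rosati G A) * B = B * (A + rosati G A))
    (hfk : ∀ z ∈ F, (∀ B ∈ F, z * B = B * z) → rosati G z = z)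
    (hdim : finrank ℚ F = Fintype.card κ) :
    ∃ P : endAlgRat Ψ, IsIdempotentElem P ∧ IsIsogenous Ψ (powPeriod (idemPeriod Ψ P) 2) ∧
      2 * finrank ℂ (cxSpan Ψ (idemSubspace (P : Matrix κ κ ℚ))) = finrank ℂ E := by
  obtain ⟨P, hPi, -, -, hiso, hrk⟩ :=
    exists_isIsogenous_powPeriod_two_of_typeIII_sub hη hG F hF hFr hdiv hcen hfk hdim
  refine ⟨P, hPi, hiso, ?_⟩
  have h1 := subRank_eq_two_mul_finrank Ψ (isLatticeSubspace_idemSubspace (P : Matrix κ κ ℚ))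
    (isComplexSubspace_idemSubspace Ψ P.2)
  have h2 := card_eq_two_mul_finrank Ψ
  omega

/-- **`X` is not simple** (a non-trivial idempotent of `End_ℚ(X)`; for `X` simple every non-zero
endomorphism is invertible). In particular a SIMPLE polarised torus admits no such `F` — recovering the
conclusion of `IsSimple.finrank_endAlgRat_ne_card_of_isAlbertTypeIII` (p12) for `F = End_ℚ(X)`.
[cite: HulekLaface2019PicardNumbersAV, §5.1 Prop. 5.1, exceptional case (1): "contradicting the fact that `X` is simple" (arXiv p. 10)] -/
theorem not_isSimple_of_typeIII_sub (hη : IsRiemannForm Ψ η)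
    (hG : G.map (Rat.cast : ℚ → ℝ) = latticeGram Ψ η) (F : Subalgebra ℚ (Matrix κ κ ℚ))
    (hF : F ≤ endAlgRat Ψ) (hFr : ∀ A ∈ F, rosati G A ∈ F) (hdiv : ∀ A ∈ F, A ≠ 0 → IsUnit A)
    (hcen : ∀ A ∈ F, ∀ B ∈ F, (A + rosati G A) * B = B * (A + rosati G A))
    (hfk : ∀ z ∈ F, (∀ B ∈ F, z * B = B * z) → rosati G z = z)
    (hdim : finrank ℚ F = Fintype.card κ) : ¬ IsSimple Ψ := by
  intro hX
  obtain ⟨P, hPi, hP0, hP1, -, -⟩ :=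
    exists_isIsogenous_powPeriod_two_of_typeIII_sub hη hG F hF hFr hdiv hcen hfk hdim
  have hP0' : (P : Matrix κ κ ℚ) ≠ 0 := fun h ↦ hP0 (Subtype.ext h)
  have hu : IsUnit (P : Matrix κ κ ℚ) := hX.isUnit_of_mem_endAlgRat P.2 hP0'
  have hPP : (P : Matrix κ κ ℚ) * (P : Matrix κ κ ℚ) = P := congrArg Subtype.val hPi.eq
  apply hP1
  refine Subtype.ext ?_
  obtain ⟨w, hw⟩ := hu
  have h1 : (w : Matrix κ κ ℚ)⁻¹ * ((P : Matrix κ κ ℚ) * P) = (w : Matrix κ κ ℚ)⁻¹ * P := by rw [hPP]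
  have hwu : IsUnit (w : Matrix κ κ ℚ).det := (Matrix.isUnit_iff_isUnit_det _).1 w.isUnit
  rw [← hw, ← Matrix.mul_assoc, Matrix.nonsing_inv_mul _ hwu, Matrix.one_mul] at h1
  rw [Subalgebra.coe_one, ← hw]
  exact h1

/-- **`End_ℚ(X) ⊋ F`**: the endomorphism algebra is strictly larger than `F` (it contains the skew
commutant element `a = R_ξ ∉ F`) — Shimura: for type III with `m = 1` "a general member" does NOT have
`End_ℚ(X) = ι(F)`. [cite: HulekLaface2019PicardNumbersAV, §5.1 Prop. 5.1 and proof ("a general member […] has the property `End_ℚ(X) = ι(F)`, except in the cases above") (arXiv p. 10)] -/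
theorem exists_mem_endAlgRat_not_mem_of_typeIII_sub (hη : IsRiemannForm Ψ η)
    (hG : G.map (Rat.cast : ℚ → ℝ) = latticeGram Ψ η) (F : Subalgebra ℚ (Matrix κ κ ℚ))
    (hF : F ≤ endAlgRat Ψ) (hFr : ∀ A ∈ F, rosati G A ∈ F) (hdiv : ∀ A ∈ F, A ≠ 0 → IsUnit A)
    (hcen : ∀ A ∈ F, ∀ B ∈ F, (A + rosati G A) * B = B * (A + rosati G A))
    (hfk : ∀ z ∈ F, (∀ B ∈ F, z * B = B * z) → rosati G z = z)
    (hdim : finrank ℚ F = Fintype.card κ) :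
    ∃ a ∈ endAlgRat Ψ, a ∉ F ∧ a ≠ 0 ∧ a ∈ Subalgebra.centralizer ℚ (F : Set (Matrix κ κ ℚ)) ∧
      rosati G a = -a ∧ ∃ ξ ∈ F, a * a = ξ * ξ := by
  obtain ⟨ξ, hξF, a, haE, j, -, -, -, -, -, haC, ha0, haskew, haa, haF, -⟩ :=
    exists_skew_data_of_typeIII_sub hη hG F hF hFr hdiv hcen hfk hdim
  exact ⟨a, haE, haF, ha0, haC, haskew, ξ, hξF, haa⟩

end Torus

/-! ## §4 The complex multiplication of `Y = X^P`: the field `L = F ∩ C(ξ) = Z(F)(ξ)` -/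

section CMField

variable {ι : Type*} [Fintype ι] [DecidableEq ι]

/-- `†`-symmetric elements of `F` are central in `F` when `A + A†` is central for every `A ∈ F`
(`2x = x + x†`). [cite: Lange2023AbelianVarietiesComplex, §2.6.2 Thm. 2.6.5 (c) (`x' = x̄`: the symmetric elements of a type-III pair are the centre)] -/
theorem mul_comm_of_rosati_eq_self (F : Subalgebra ℚ (Matrix ι ι ℚ)) {G : Matrix ι ι ℚ}
    (hcen : ∀ A ∈ F, ∀ B ∈ F, (A + rosati G A) * B = B * (A + rosati G A)) {x : Matrix ι ι ℚ}
    (hx : x ∈ F) (hsym : rosati G x = x) {B : Matrix ι ι ℚ} (hB : B ∈ F) : x * B = B * x := by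
  have h := hcen x hx B hB
  rw [hsym, ← two_smul ℚ, Matrix.smul_mul, Matrix.mul_smul] at h
  exact smul_right_injective (Matrix ι ι ℚ) two_ne_zero h

/-- `(s + w)(s' + w') = (s' + w')(s + w)` when the four elementary products commute. [folklore] -/
private theorem add_mul_add_comm_of_comm {R : Type*} [Ring R] {s w s' w' : R} (h₁ : s * s' = s' * s)
    (h₂ : s * w' = w' * s) (h₃ : w * s' = s' * w) (h₄ : w * w' = w' * w) :
    (s + w) * (s' + w') = (s' + w') * (s + w) := by
  rw [add_mul, mul_add, mul_add, add_mul, mul_add, mul_add, h₁, h₂, h₃, h₄]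
  abel

/-- **`C_F(ξ)` is commutative.** In the situation of §1 (`†` preserves `F`, `A + A†` central in `F`,
`ξ ∈ F` an invertible `†`-skew element): two elements of `F` commuting with `ξ` commute with each other.
(Write `2A = (A + A†) + w_A`; the skew part `w_A` commutes with `ξ` and `w_A ξ` is symmetric, hence
central; so `w_A w_B ξ² = (w_A ξ)(w_B ξ) = (w_B ξ)(w_A ξ) = w_B w_A ξ²`.)  For a quaternion algebra this is
"`K(ξ)` is a maximal subfield". [cite: Lange2023AbelianVarietiesComplex, §2.6.2 Thm. 2.6.5 (c) and its proof, Step III (p0142)] -/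
theorem mul_comm_of_commute_skew (F : Subalgebra ℚ (Matrix ι ι ℚ)) {G : Matrix ι ι ℚ} (hGu : IsUnit G.det)
    (hGt : Gᵀ = -G) (hFr : ∀ A ∈ F, rosati G A ∈ F)
    (hcen : ∀ A ∈ F, ∀ B ∈ F, (A + rosati G A) * B = B * (A + rosati G A)) {ξ : Matrix ι ι ℚ}
    (hξF : ξ ∈ F) (hξskew : rosati G ξ = -ξ) (hξu : IsUnit ξ.det) {A B : Matrix ι ι ℚ} (hA : A ∈ F)
    (hB : B ∈ F) (hAξ : ξ * A = A * ξ) (hBξ : ξ * B = B * ξ) : A * B = B * A := by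
  have hqu : IsUnit (ξ * ξ) := by
    rw [Matrix.isUnit_iff_isUnit_det, Matrix.det_mul]; exact hξu.mul hξu
  -- the skew parts `w = C - C†` commute with `ξ`, and `w ξ` is central
  have skew_part : ∀ {C : Matrix ι ι ℚ}, C ∈ F → ξ * C = C * ξ →
      ξ * (C - rosati G C) = (C - rosati G C) * ξ ∧
        ∀ D ∈ F, (C - rosati G C) * ξ * D = D * ((C - rosati G C) * ξ) := by
    intro C hC hCξ
    have hC' : ξ * rosati G C = rosati G C * ξ := by
      have h := congrArg (rosati G) hCξ
      rw [rosati_mul hGu, rosati_mul hGu, hξskew, Matrix.mul_neg, Matrix.neg_mul, neg_inj] at h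
      exact h.symm
    have hwξ : ξ * (C - rosati G C) = (C - rosati G C) * ξ := by
      rw [Matrix.mul_sub, Matrix.sub_mul, hCξ, hC']
    refine ⟨hwξ, fun D hD ↦ ?_⟩
    have hsym : rosati G ((C - rosati G C) * ξ) = (C - rosati G C) * ξ := by
      rw [rosati_mul hGu, hξskew, rosati_sub, rosati_rosati hGu hGt, ← hwξ, Matrix.neg_mul, ← Matrix.mul_neg,
        neg_sub]
    exact mul_comm_of_rosati_eq_self F hcen (F.mul_mem (F.sub_mem hC (hFr C hC)) hξF) hsym hD
  obtain ⟨hwAξ, hwAc⟩ := skew_part hA hAξ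
  obtain ⟨hwBξ, hwBc⟩ := skew_part hB hBξ
  set wA := A - rosati G A with hwA_def
  set wB := B - rosati G B with hwB_def
  have hwAF : wA ∈ F := F.sub_mem hA (hFr A hA)
  have hwBF : wB ∈ F := F.sub_mem hB (hFr B hB)
  -- `wA wB = wB wA`
  have hww : wA * wB = wB * wA := by
    have h1 : wA * wB * (ξ * ξ) = wB * wA * (ξ * ξ) := by
      calc wA * wB * (ξ * ξ) = wA * (wB * ξ) * ξ := by simp only [Matrix.mul_assoc]
        _ = wB * ξ * wA * ξ := by rw [hwBc wA hwAF]
        _ = wB * (ξ * wA) * ξ := by simp only [Matrix.mul_assoc]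
        _ = wB * wA * (ξ * ξ) := by rw [hwAξ]; simp only [Matrix.mul_assoc]
    have h2 : (wA * wB - wB * wA) * (ξ * ξ) = 0 := by rw [Matrix.sub_mul, h1, sub_self]
    exact sub_eq_zero.1 ((hqu.mul_left_eq_zero).1 h2)
  -- `2A = (A + A†) + wA`, `2B = (B + B†) + wB`, and everything matches
  have h2A : (2 : ℚ) • A = (A + rosati G A) + wA := by rw [hwA_def, two_smul]; abel
  have h2B : (2 : ℚ) • B = (B + rosati G B) + wB := by rw [hwB_def, two_smul]; abel
  have key : ((2 : ℚ) • A) * ((2 : ℚ) • B) = ((2 : ℚ) • B) * ((2 : ℚ) • A) := by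
    rw [h2A, h2B]
    exact add_mul_add_comm_of_comm (hcen A hA _ (F.add_mem hB (hFr B hB))) (hcen A hA _ hwBF)
      (hcen B hB _ hwAF).symm hww
  rw [Matrix.smul_mul, Matrix.mul_smul, Matrix.smul_mul, Matrix.mul_smul, smul_smul, smul_smul] at key
  exact smul_right_injective (Matrix ι ι ℚ) (by norm_num : (2 : ℚ) * 2 ≠ 0) key

/-- `ξ j⁻¹ = -j⁻¹ ξ` from `j ξ = -ξ j` (`j` invertible). [folklore] -/
private theorem mul_nonsing_inv_eq_neg_of_anticommute {ξ j : Matrix ι ι ℚ} (hju : IsUnit j.det)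
    (hjξ : j * ξ = -(ξ * j)) : ξ * j⁻¹ = -(j⁻¹ * ξ) := by
  have h : j⁻¹ * (j * ξ) * j⁻¹ = j⁻¹ * (-(ξ * j)) * j⁻¹ := by rw [hjξ]
  rwa [← Matrix.mul_assoc, Matrix.nonsing_inv_mul _ hju, Matrix.one_mul, Matrix.mul_neg, Matrix.neg_mul,
    Matrix.mul_assoc, Matrix.mul_assoc, Matrix.mul_nonsing_inv _ hju, Matrix.mul_one] at h

/-- **`F = L ⊕ L j`, so `dim_ℚ F = 2 dim_ℚ L` for `L = F ∩ C(ξ)`.**  For a subalgebra `F ⊆ M_ι(ℚ)`, an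
invertible `ξ ∈ F` with `ξ²` central in `F`, and an invertible `j ∈ F` anticommuting with `ξ`: `F` is the
direct sum of the `(+1)`- and `(-1)`-eigenspaces of the inner involution `x ↦ ξ x ξ⁻¹`, namely
`L = F ∩ C(ξ)` and `{x ∈ F | ξ x = -x ξ} = j · L`, and left multiplication by `j` is injective.  (For a
quaternion algebra: `F = K(ξ) ⊕ K(ξ) j`, `[F : K(ξ)] = 2` — the elementary half of "the rank of `F` over `K`
is either `1` or `4`", Lange Thm. 2.6.5, proof, Step I.)
[cite: Lange2023AbelianVarietiesComplex, §2.6.2 Thm. 2.6.5, proof, Step I ("`F` is either `K` […] or a quaternion algebra over `K`"), PDF p0142] -/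
theorem finrank_eq_two_mul_finrank_inf_centralizer (F : Subalgebra ℚ (Matrix ι ι ℚ)) {ξ j : Matrix ι ι ℚ}
    (hξF : ξ ∈ F) (hξu : IsUnit ξ.det) (hq : ∀ B ∈ F, ξ * ξ * B = B * (ξ * ξ)) (hjF : j ∈ F)
    (hju : IsUnit j.det) (hjξ : j * ξ = -(ξ * j)) :
    finrank ℚ F = 2 * finrank ℚ ↥(F ⊓ Subalgebra.centralizer ℚ ({ξ} : Set (Matrix ι ι ℚ))) := by
  classical
  set V : Submodule ℚ (Matrix ι ι ℚ) := Subalgebra.toSubmodule F with hV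
  set Cp : Submodule ℚ (Matrix ι ι ℚ) :=
    Subalgebra.toSubmodule (Subalgebra.centralizer ℚ ({ξ} : Set (Matrix ι ι ℚ))) with hCp
  set Lp : Submodule ℚ (Matrix ι ι ℚ) := V ⊓ Cp with hLp
  set Lm : Submodule ℚ (Matrix ι ι ℚ) :=
    V ⊓ LinearMap.ker (LinearMap.mulLeft ℚ ξ + LinearMap.mulRight ℚ ξ) with hLm
  have memCp : ∀ A : Matrix ι ι ℚ, A ∈ Cp ↔ ξ * A = A * ξ := by
    intro A
    rw [hCp, Subalgebra.mem_toSubmodule, Subalgebra.mem_centralizer_iff]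
    simp only [Set.mem_singleton_iff, forall_eq]
  have memLp : ∀ A : Matrix ι ι ℚ, A ∈ Lp ↔ A ∈ F ∧ ξ * A = A * ξ := by
    intro A
    rw [hLp, Submodule.mem_inf, memCp, hV, Subalgebra.mem_toSubmodule]
  have memLm : ∀ A : Matrix ι ι ℚ, A ∈ Lm ↔ A ∈ F ∧ ξ * A + A * ξ = 0 := by
    intro A
    rw [hLm, Submodule.mem_inf, LinearMap.mem_ker, LinearMap.add_apply, LinearMap.mulLeft_apply,
      LinearMap.mulRight_apply, hV, Subalgebra.mem_toSubmodule]
  have hξinvF : ξ⁻¹ ∈ F := nonsing_inv_mem_subalgebra F hξF hξu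
  have hjinvF : j⁻¹ ∈ F := nonsing_inv_mem_subalgebra F hjF hju
  -- (i) `Lp ⊓ Lm = ⊥`
  have hinf : Lp ⊓ Lm = ⊥ := by
    rw [Submodule.eq_bot_iff]
    intro A hA
    obtain ⟨hAp, hAm⟩ := Submodule.mem_inf.1 hA
    obtain ⟨-, hAp⟩ := (memLp A).1 hAp
    obtain ⟨-, hAm⟩ := (memLm A).1 hAm
    rw [← hAp, ← two_smul ℚ] at hAm
    have h1 : ξ * A = 0 := (smul_eq_zero.1 hAm).resolve_left two_ne_zero
    have h2 : ξ⁻¹ * (ξ * A) = 0 := by rw [h1, Matrix.mul_zero]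
    rwa [← Matrix.mul_assoc, Matrix.nonsing_inv_mul _ hξu, Matrix.one_mul] at h2
  -- (ii) `Lp ⊔ Lm = V`
  have hsup : Lp ⊔ Lm = V := by
    refine le_antisymm (sup_le inf_le_left inf_le_left) fun A hA ↦ ?_
    have hAF : A ∈ F := by rwa [hV, Subalgebra.mem_toSubmodule] at hA
    have hcF : ξ * A * ξ⁻¹ ∈ F := F.mul_mem (F.mul_mem hξF hAF) hξinvF
    have e1 : ξ * ξ * A * ξ⁻¹ = A * ξ := by
      rw [hq A hAF, Matrix.mul_assoc, Matrix.mul_assoc, Matrix.mul_nonsing_inv _ hξu, Matrix.mul_one]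
    have e2 : ξ * A * ξ⁻¹ * ξ = ξ * A := by
      rw [Matrix.mul_assoc, Matrix.nonsing_inv_mul _ hξu, Matrix.mul_one]
    rw [Submodule.mem_sup]
    refine ⟨(1 / 2 : ℚ) • (A + ξ * A * ξ⁻¹), ?_, (1 / 2 : ℚ) • (A - ξ * A * ξ⁻¹), ?_, ?_⟩
    · rw [memLp]
      refine ⟨F.smul_mem (F.add_mem hAF hcF) _, ?_⟩
      rw [Matrix.mul_smul, Matrix.smul_mul, Matrix.mul_add, Matrix.add_mul, ← Matrix.mul_assoc,
        ← Matrix.mul_assoc, e1, e2, add_comm]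
    · rw [memLm]
      refine ⟨F.smul_mem (F.sub_mem hAF hcF) _, ?_⟩
      rw [Matrix.mul_smul, Matrix.smul_mul, ← smul_add, Matrix.mul_sub, Matrix.sub_mul, ← Matrix.mul_assoc,
        ← Matrix.mul_assoc, e1, e2, sub_add_sub_cancel', sub_self, smul_zero]
    · rw [← smul_add, add_add_sub_cancel, ← two_smul ℚ, smul_smul]
      norm_num
  -- (iii) `Lm = j · Lp`
  have hξjinv : ξ * j⁻¹ = -(j⁻¹ * ξ) := mul_nonsing_inv_eq_neg_of_anticommute hju hjξ
  have hmap : Lp.map (LinearMap.mulLeft ℚ j) = Lm := by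
    ext B
    rw [Submodule.mem_map, memLm]
    constructor
    · rintro ⟨A, hA, rfl⟩
      obtain ⟨hAF, hAξ⟩ := (memLp A).1 hA
      refine ⟨F.mul_mem hjF hAF, ?_⟩
      rw [LinearMap.mulLeft_apply, ← Matrix.mul_assoc, ← neg_neg (ξ * j), ← hjξ, Matrix.neg_mul,
        Matrix.mul_assoc, Matrix.mul_assoc, ← hAξ, neg_add_cancel]
    · rintro ⟨hBF, hBξ⟩
      refine ⟨j⁻¹ * B, (memLp _).2 ⟨F.mul_mem hjinvF hBF, ?_⟩, ?_⟩
      · have hBξ' : ξ * B = -(B * ξ) := eq_neg_of_add_eq_zero_left hBξ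
        rw [← Matrix.mul_assoc, hξjinv, Matrix.neg_mul, Matrix.mul_assoc, hBξ', Matrix.mul_neg, neg_neg,
          Matrix.mul_assoc]
      · rw [LinearMap.mulLeft_apply, ← Matrix.mul_assoc, Matrix.mul_nonsing_inv _ hju, Matrix.one_mul]
  -- (iv) `x ↦ j x` is injective
  have hinj : Function.Injective (LinearMap.mulLeft ℚ j : Matrix ι ι ℚ →ₗ[ℚ] Matrix ι ι ℚ) := by
    intro A B hAB
    simp only [LinearMap.mulLeft_apply] at hAB
    have h := congrArg (fun M ↦ j⁻¹ * M) hAB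
    simpa only [← Matrix.mul_assoc, Matrix.nonsing_inv_mul _ hju, Matrix.one_mul] using h
  -- dimension count
  have hdim := Submodule.finrank_sup_add_finrank_inf_eq Lp Lm
  rw [hinf, finrank_bot, add_zero, hsup] at hdim
  have hLm_eq : finrank ℚ Lm = finrank ℚ Lp := by
    rw [← hmap]
    exact (Submodule.equivMapOfInjective _ hinj Lp).finrank_eq.symm
  have hLp_eq : finrank ℚ Lp = finrank ℚ ↥(F ⊓ Subalgebra.centralizer ℚ ({ξ} : Set (Matrix ι ι ℚ))) := by
    rw [← Subalgebra.finrank_toSubmodule, Algebra.inf_toSubmodule]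
  rw [← Subalgebra.finrank_toSubmodule, ← hV, hdim, hLm_eq, hLp_eq, two_mul]


/-! ### `L = Z(F) ⊕ Z(F) ξ`: the centre has dimension `e = ¼ [F:ℚ]` -/

/-- **`dim_ℚ (F ∩ C(ξ)) = 2 · dim_ℚ Z(F)`.**  In the situation of §1 with `†` of the first kind on `F`
(`z† = z` on `Z(F)`): the `†`-symmetric elements of `F` are exactly the centre `Z(F)` (`2x = x + x†` is
central; conversely central elements are `†`-fixed), `L = F ∩ C(ξ)` is `†`-stable and splits as
`L = (L ∩ Sym) ⊕ (L ∩ Skew) = Z(F) ⊕ Z(F)·ξ` (`w ↦ w ξ` exchanges the two summands).  Hence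
`[L : ℚ] = 2e` with `e = [Z(F) : ℚ]` — "`Y` is an abelian variety of dimension `e`"; with
`finrank_eq_two_mul_finrank_inf_centralizer` this is "the rank of `F` over `K` is `4`" (Thm. 2.6.5, Step I).
[cite: Lange2023AbelianVarietiesComplex, §2.6.2 Thm. 2.6.5, proof, Step I, PDF p0142]
[cite: HulekLaface2019PicardNumbersAV, §5.1 Prop. 5.1, exceptional case (1) ("of dimension `e₀`") and §2 (`e = [K:ℚ]`) (arXiv p. 10)]
[cite: Lange2023AbelianVarietiesComplex, §2.6.2 Thm. 2.6.5 (c) (`x' = x̄`, `K = {x | x' = x}`), PDF p0141–p0142] -/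
theorem finrank_inf_centralizer_eq_two_mul_finrank_center (F : Subalgebra ℚ (Matrix ι ι ℚ))
    {G : Matrix ι ι ℚ} (hGu : IsUnit G.det) (hGt : Gᵀ = -G) (hFr : ∀ A ∈ F, rosati G A ∈ F)
    (hcen : ∀ A ∈ F, ∀ B ∈ F, (A + rosati G A) * B = B * (A + rosati G A))
    (hfk : ∀ z ∈ F, (∀ B ∈ F, z * B = B * z) → rosati G z = z) {ξ : Matrix ι ι ℚ} (hξF : ξ ∈ F)
    (hξskew : rosati G ξ = -ξ) (hξu : IsUnit ξ.det) :
    finrank ℚ ↥(F ⊓ Subalgebra.centralizer ℚ ({ξ} : Set (Matrix ι ι ℚ))) =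
      2 * finrank ℚ ↥(F ⊓ Subalgebra.centralizer ℚ (F : Set (Matrix ι ι ℚ))) := by
  classical
  set Lp : Submodule ℚ (Matrix ι ι ℚ) :=
    Subalgebra.toSubmodule (F ⊓ Subalgebra.centralizer ℚ ({ξ} : Set (Matrix ι ι ℚ))) with hLp
  set Z : Submodule ℚ (Matrix ι ι ℚ) :=
    Subalgebra.toSubmodule (F ⊓ Subalgebra.centralizer ℚ (F : Set (Matrix ι ι ℚ))) with hZ
  set S : Submodule ℚ (Matrix ι ι ℚ) := Lp ⊓ LinearMap.ker (rosatiLinear G - LinearMap.id) with hS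
  set W : Submodule ℚ (Matrix ι ι ℚ) := Lp ⊓ LinearMap.ker (rosatiLinear G + LinearMap.id) with hW
  have memLp : ∀ A : Matrix ι ι ℚ, A ∈ Lp ↔ A ∈ F ∧ ξ * A = A * ξ := by
    intro A
    rw [hLp, Subalgebra.mem_toSubmodule, Algebra.mem_inf, Subalgebra.mem_centralizer_iff]
    simp only [Set.mem_singleton_iff, forall_eq]
  have memZ : ∀ A : Matrix ι ι ℚ, A ∈ Z ↔ A ∈ F ∧ ∀ B ∈ F, A * B = B * A := by
    intro A
    rw [hZ, Subalgebra.mem_toSubmodule, Algebra.mem_inf, Subalgebra.mem_centralizer_iff]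
    exact ⟨fun ⟨h1, h2⟩ ↦ ⟨h1, fun B hB ↦ (h2 B hB).symm⟩, fun ⟨h1, h2⟩ ↦ ⟨h1, fun B hB ↦ (h2 B hB).symm⟩⟩
  have memS : ∀ A : Matrix ι ι ℚ, A ∈ S ↔ (A ∈ F ∧ ξ * A = A * ξ) ∧ rosati G A = A := by
    intro A
    rw [hS, Submodule.mem_inf, memLp, LinearMap.mem_ker, LinearMap.sub_apply, rosatiLinear_apply,
      LinearMap.id_apply, sub_eq_zero]
  have memW : ∀ A : Matrix ι ι ℚ, A ∈ W ↔ (A ∈ F ∧ ξ * A = A * ξ) ∧ rosati G A = -A := by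
    intro A
    rw [hW, Submodule.mem_inf, memLp, LinearMap.mem_ker, LinearMap.add_apply, rosatiLinear_apply,
      LinearMap.id_apply, add_eq_zero_iff_eq_neg]
  -- symmetric elements of `F` are central; central elements are symmetric
  have sym_central : ∀ {x : Matrix ι ι ℚ}, x ∈ F → rosati G x = x → ∀ B ∈ F, x * B = B * x :=
    fun hx hsym B hB ↦ mul_comm_of_rosati_eq_self F hcen hx hsym hB
  -- (1) `S ⊓ W = ⊥`
  have hinf : S ⊓ W = ⊥ := by
    rw [Submodule.eq_bot_iff]
    intro A hA
    obtain ⟨hAS, hAW⟩ := Submodule.mem_inf.1 hA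
    have h1 := ((memS A).1 hAS).2
    have h2 := ((memW A).1 hAW).2
    have h : (2 : ℚ) • A = 0 := by rw [two_smul]; nth_rw 1 [← h1]; rw [h2, neg_add_cancel]
    exact (smul_eq_zero.1 h).resolve_left two_ne_zero
  -- (2) `S ⊔ W = Lp`
  have hsup : S ⊔ W = Lp := by
    refine le_antisymm (sup_le inf_le_left inf_le_left) fun A hA ↦ ?_
    obtain ⟨hAF, hAξ⟩ := (memLp A).1 hA
    have hA'F : rosati G A ∈ F := hFr A hAF
    have hA'ξ : ξ * rosati G A = rosati G A * ξ := by
      have h := congrArg (rosati G) hAξ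
      rw [rosati_mul hGu, rosati_mul hGu, hξskew, Matrix.mul_neg, Matrix.neg_mul, neg_inj] at h
      exact h.symm
    rw [Submodule.mem_sup]
    refine ⟨(1 / 2 : ℚ) • (A + rosati G A), ?_, (1 / 2 : ℚ) • (A - rosati G A), ?_, ?_⟩
    · rw [memS]
      refine ⟨⟨F.smul_mem (F.add_mem hAF hA'F) _, ?_⟩, ?_⟩
      · rw [Matrix.mul_smul, Matrix.smul_mul, Matrix.mul_add, Matrix.add_mul, hAξ, hA'ξ]
      · rw [rosati_smul, rosati_add, rosati_rosati hGu hGt, add_comm]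
    · rw [memW]
      refine ⟨⟨F.smul_mem (F.sub_mem hAF hA'F) _, ?_⟩, ?_⟩
      · rw [Matrix.mul_smul, Matrix.smul_mul, Matrix.mul_sub, Matrix.sub_mul, hAξ, hA'ξ]
      · rw [rosati_smul, rosati_sub, rosati_rosati hGu hGt, ← smul_neg, neg_sub]
    · rw [← smul_add, add_add_sub_cancel, ← two_smul ℚ, smul_smul]
      norm_num
  -- (3) `S = Z(F)`
  have hSZ : S = Z := by
    ext A
    rw [memS, memZ]
    constructor
    · rintro ⟨⟨hAF, -⟩, hsym⟩
      exact ⟨hAF, sym_central hAF hsym⟩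
    · rintro ⟨hAF, hAc⟩
      exact ⟨⟨hAF, (hAc ξ hξF).symm⟩, hfk A hAF hAc⟩
  -- (4) `W = S · ξ`
  have hξinvF : ξ⁻¹ ∈ F := nonsing_inv_mem_subalgebra F hξF hξu
  have hqu : IsUnit (ξ * ξ).det := by rw [Matrix.det_mul]; exact hξu.mul hξu
  have hqinvF : (ξ * ξ)⁻¹ ∈ F := nonsing_inv_mem_subalgebra F (F.mul_mem hξF hξF) hqu
  have hξinv_eq : ξ⁻¹ = ξ * (ξ * ξ)⁻¹ :=
    Matrix.inv_eq_right_inv (by rw [← Matrix.mul_assoc, Matrix.mul_nonsing_inv _ hqu])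
  have hmap : S.map (LinearMap.mulRight ℚ ξ) = W := by
    ext B
    rw [Submodule.mem_map, memW]
    constructor
    · rintro ⟨s, hs, rfl⟩
      obtain ⟨⟨hsF, hsξ⟩, hssym⟩ := (memS s).1 hs
      rw [LinearMap.mulRight_apply]
      refine ⟨⟨F.mul_mem hsF hξF, by rw [← Matrix.mul_assoc, hsξ]⟩, ?_⟩
      rw [rosati_mul hGu, hξskew, hssym, Matrix.neg_mul, hsξ]
    · rintro ⟨⟨hBF, hBξ⟩, hBskew⟩
      -- `B ξ` is symmetric, hence central; `(ξ²)⁻¹` is central, hence symmetric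
      have hBξsym : rosati G (B * ξ) = B * ξ := by
        rw [rosati_mul hGu, hξskew, hBskew, neg_mul_neg, hBξ]
      have hqc : ∀ D ∈ F, ξ * ξ * D = D * (ξ * ξ) := by
        intro D hD
        have hqsym : rosati G (ξ * ξ) = ξ * ξ := by rw [rosati_mul hGu, hξskew, neg_mul_neg]
        exact sym_central (F.mul_mem hξF hξF) hqsym D hD
      have hqic : ∀ D ∈ F, (ξ * ξ)⁻¹ * D = D * (ξ * ξ)⁻¹ := fun D hD ↦
        nonsing_inv_mul_comm_of_comm hqu (hqc D hD)
      have hqisym : rosati G (ξ * ξ)⁻¹ = (ξ * ξ)⁻¹ := hfk _ hqinvF hqic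
      refine ⟨B * ξ⁻¹, (memS _).2 ⟨⟨F.mul_mem hBF hξinvF, ?_⟩, ?_⟩, ?_⟩
      · rw [← Matrix.mul_assoc, hBξ, Matrix.mul_assoc, Matrix.mul_nonsing_inv _ hξu, Matrix.mul_assoc,
          Matrix.nonsing_inv_mul _ hξu]
      · rw [hξinv_eq, ← Matrix.mul_assoc, rosati_mul hGu, hqisym, hBξsym, hqic _ (F.mul_mem hBF hξF)]
      · rw [LinearMap.mulRight_apply, Matrix.mul_assoc, Matrix.nonsing_inv_mul _ hξu, Matrix.mul_one]
  -- (5) `x ↦ x ξ` is injective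
  have hinj : Function.Injective (LinearMap.mulRight ℚ ξ : Matrix ι ι ℚ →ₗ[ℚ] Matrix ι ι ℚ) := by
    intro A B hAB
    simp only [LinearMap.mulRight_apply] at hAB
    have h := congrArg (fun M ↦ M * ξ⁻¹) hAB
    simpa only [Matrix.mul_assoc, Matrix.mul_nonsing_inv _ hξu, Matrix.mul_one] using h
  -- dimension count
  have hdim := Submodule.finrank_sup_add_finrank_inf_eq S W
  rw [hinf, finrank_bot, add_zero, hsup] at hdim
  have hW_eq : finrank ℚ W = finrank ℚ S := by
    rw [← hmap]
    exact (Submodule.equivMapOfInjective _ hinj S).finrank_eq.symm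
  rw [← Subalgebra.finrank_toSubmodule, ← Subalgebra.finrank_toSubmodule, ← hLp, ← hZ, hdim, hW_eq, hSZ,
    two_mul]


end CMField

/-! ### The restriction of `L = F ∩ C(ξ)` to `Y = X^P` -/

section Restriction

variable {κ : Type} [Fintype κ] [DecidableEq κ] [Nonempty κ] {E : Type*} [NormedAddCommGroup E]
  [NormedSpace ℂ E] {Ψ : (κ → ℝ) ≃L[ℝ] E} {η : E [⋀^Fin 2]→L[ℝ] ℝ} {G : Matrix κ κ ℚ}

/-- **`rk Λ = [F : ℚ] = 4e`, `e = [Z(F) : ℚ]`: `F` is a quaternion algebra over its centre and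
`dim X = 2e`** — the numerology "type III, `[F:ℚ] = 4e`, `m := g/2e = 1`" is FORCED by the shape of the
involution (`†` of the first kind with `A + A†` central on a skew field carrying the polarisation): from
`F = L ⊕ Lj` and `L = Z(F) ⊕ Z(F)ξ`.
[cite: HulekLaface2019PicardNumbersAV, §2 and §5.1 Prop. 5.1, case (1) (`e = [K:ℚ]`, `[F:ℚ] = 4e`, `m = g/2e`) (arXiv p. 10)]
[cite: Lange2023AbelianVarietiesComplex, §2.6.1 table (totally definite quaternion algebra: `d = 2`, `e₀ = e`), PDF p0138] -/
theorem card_eq_four_mul_finrank_center_of_typeIII_sub (hη : IsRiemannForm Ψ η)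
    (hG : G.map (Rat.cast : ℚ → ℝ) = latticeGram Ψ η) (F : Subalgebra ℚ (Matrix κ κ ℚ))
    (hF : F ≤ endAlgRat Ψ) (hFr : ∀ A ∈ F, rosati G A ∈ F) (hdiv : ∀ A ∈ F, A ≠ 0 → IsUnit A)
    (hcen : ∀ A ∈ F, ∀ B ∈ F, (A + rosati G A) * B = B * (A + rosati G A))
    (hfk : ∀ z ∈ F, (∀ B ∈ F, z * B = B * z) → rosati G z = z)
    (hdim : finrank ℚ F = Fintype.card κ) :
    Fintype.card κ = 4 * finrank ℚ ↥(F ⊓ Subalgebra.centralizer ℚ (F : Set (Matrix κ κ ℚ))) := by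
  have hGu : IsUnit G.det := isUnit_det_of_map_ratCast hG hη.isUnit_det_latticeGram
  have hGt : Gᵀ = -G := transpose_eq_neg_of_map_ratCast Ψ hG
  obtain ⟨ξ, hξF, a, -, j, hjF, hξ0, hξskew, hqcen, -, -, -, -, -, -, hj0, hjξ⟩ :=
    exists_skew_data_of_typeIII_sub hη hG F hF hFr hdiv hcen hfk hdim
  have hξu : IsUnit ξ.det := (Matrix.isUnit_iff_isUnit_det _).1 (hdiv ξ hξF hξ0)
  have hju : IsUnit j.det := (Matrix.isUnit_iff_isUnit_det _).1 (hdiv j hjF hj0)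
  rw [← hdim, finrank_eq_two_mul_finrank_inf_centralizer F hξF hξu hqcen hjF hju hjξ,
    finrank_inf_centralizer_eq_two_mul_finrank_center F hGu hGt hFr hcen hfk hξF hξskew hξu]
  ring

/-- **Hulek–Laface Prop. 5.1, case (1), with the complex multiplication of the factor (Shimura 1963 §4:
the type-III family with `m = 1` is zero-dimensional).**  In the situation of
`exists_isIsogenous_powPeriod_two_of_typeIII_sub` (a polarised complex torus `X` whose `End_ℚ(X)`
contains a `†`-stable skew field `F` of `ℚ`-dimension `rk Λ` with `†|_F` of the first kind and
`A + A†` central): there is an idempotent `0 ≠ P ≠ 1` of `End_ℚ(X)` with `X ∼ X^P × X^P`,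
`rk Λ(X^P) = ½ rk Λ`, AND the endomorphism algebra `End_ℚ(X^P)` of the factor contains a commutative
`ℚ`-subalgebra `L` which is a field (every non-zero element invertible) of `ℚ`-dimension `rk Λ(X^P)`
("`End_ℚ(Y)` contains a field of degree `2 dim Y`": `Y = X^P` has complex multiplication, Shimura 1998
§5.1 Prop. 3 / the tree's `IsSimple.eq_endAlgRat_of_finrank_eq_card`, `EndomorphismFieldOfFullDegree`).
`L` is the restriction to `X^P` of `F ∩ C(ξ) = Z(F) ⊕ Z(F)ξ` (`ξ` of Step 1), a maximal subfield of `F`,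
commutative by `mul_comm_of_commute_skew`, of dimension `½[F:ℚ]` by `F = L ⊕ Lj`
(`finrank_eq_two_mul_finrank_inf_centralizer`), and commuting with `P`.
[cite: HulekLaface2019PicardNumbersAV, §5.1 Prop. 5.1, exceptional case (1) and its proof (arXiv p. 10)]
[cite: Shimura1963AnalyticFamilies, §4 (type III, `m = 1`; through Hulek–Laface)]
[cite: Shimura1998, §5.1 Prop. 3, p. 36 ("If `End_ℚ(A)` contains a field `F` of degree `2n` over `ℚ` …")] -/
theorem exists_isIsogenous_powPeriod_two_cm_of_typeIII_sub (hη : IsRiemannForm Ψ η)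
    (hG : G.map (Rat.cast : ℚ → ℝ) = latticeGram Ψ η) (F : Subalgebra ℚ (Matrix κ κ ℚ))
    (hF : F ≤ endAlgRat Ψ) (hFr : ∀ A ∈ F, rosati G A ∈ F) (hdiv : ∀ A ∈ F, A ≠ 0 → IsUnit A)
    (hcen : ∀ A ∈ F, ∀ B ∈ F, (A + rosati G A) * B = B * (A + rosati G A))
    (hfk : ∀ z ∈ F, (∀ B ∈ F, z * B = B * z) → rosati G z = z)
    (hdim : finrank ℚ F = Fintype.card κ) :
    ∃ P : endAlgRat Ψ, IsIdempotentElem P ∧ P ≠ 0 ∧ P ≠ 1 ∧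
      IsIsogenous Ψ (powPeriod (idemPeriod Ψ P) 2) ∧
      2 * subRank (idemSubspace (P : Matrix κ κ ℚ)) = Fintype.card κ ∧
      subRank (idemSubspace (P : Matrix κ κ ℚ)) =
        2 * finrank ℚ ↥(F ⊓ Subalgebra.centralizer ℚ (F : Set (Matrix κ κ ℚ))) ∧
      ∃ L : Subalgebra ℚ (Matrix (Fin (subRank (idemSubspace (P : Matrix κ κ ℚ))))
          (Fin (subRank (idemSubspace (P : Matrix κ κ ℚ)))) ℚ),
        L ≤ endAlgRat (idemPeriod Ψ P) ∧ (∀ x ∈ L, ∀ y ∈ L, x * y = y * x) ∧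
        (∀ x ∈ L, x ≠ 0 → IsUnit x) ∧ finrank ℚ L = subRank (idemSubspace (P : Matrix κ κ ℚ)) := by
  classical
  have hGu : IsUnit G.det := isUnit_det_of_map_ratCast hG hη.isUnit_det_latticeGram
  have hGt : Gᵀ = -G := transpose_eq_neg_of_map_ratCast Ψ hG
  obtain ⟨ξ, hξF, a, haE, j, hjF, hξ0, hξskew, hqcen, -, haC, -, -, haa, -, hj0, hjξ⟩ :=
    exists_skew_data_of_typeIII_sub hη hG F hF hFr hdiv hcen hfk hdim
  obtain ⟨hT, hTT, hjT, -, -, -⟩ := involution_mem_endAlgRat hF hdiv hξF hξ0 haE haC haa hjF hj0 hjξ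
  have hξu : IsUnit ξ.det := (Matrix.isUnit_iff_isUnit_det _).1 (hdiv ξ hξF hξ0)
  have hju : IsUnit j.det := (Matrix.isUnit_iff_isUnit_det _).1 (hdiv j hjF hj0)
  have hqu : IsUnit (ξ * ξ).det := by rw [Matrix.det_mul]; exact hξu.mul hξu
  set T : Matrix κ κ ℚ := ξ * a * (ξ * ξ)⁻¹ with hT_def
  set σ : endAlgRat Ψ := ⟨T, hT⟩ with hσ_def
  have hσσ : σ * σ = 1 := Subtype.ext hTT
  obtain ⟨u, hu⟩ := (isUnit_endAlgRat_iff Ψ (⟨j, hF hjF⟩ : endAlgRat Ψ)).2 (hdiv j hjF hj0)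
  have huσ : ((u : endAlgRat Ψ) : Matrix κ κ ℚ) * (σ : Matrix κ κ ℚ) =
      -((σ : Matrix κ κ ℚ) * ((u : endAlgRat Ψ) : Matrix κ κ ℚ)) := by
    rw [hu]
    exact hjT
  obtain ⟨hPi, hP0, hP1, hiso, hrk⟩ := involutionIdempotent_square σ hσσ u huσ
  set P : endAlgRat Ψ := involutionIdempotent Ψ σ with hP_def
  have h4e := card_eq_four_mul_finrank_center_of_typeIII_sub hη hG F hF hFr hdiv hcen hfk hdim
  refine ⟨P, hPi, hP0, hP1, hiso, hrk, by omega, ?_⟩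
  -- the field `L₀ = F ∩ C(ξ)` upstairs
  set L₀ : Subalgebra ℚ (Matrix κ κ ℚ) := F ⊓ Subalgebra.centralizer ℚ ({ξ} : Set (Matrix κ κ ℚ)) with hL₀
  have memL₀ : ∀ A : Matrix κ κ ℚ, A ∈ L₀ ↔ A ∈ F ∧ ξ * A = A * ξ := by
    intro A
    rw [hL₀, Algebra.mem_inf, Subalgebra.mem_centralizer_iff]
    simp only [Set.mem_singleton_iff, forall_eq]
  have hcommL₀ : ∀ A ∈ L₀, ∀ B ∈ L₀, A * B = B * A := fun A hA B hB ↦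
    mul_comm_of_commute_skew F hGu hGt hFr hcen hξF hξskew hξu ((memL₀ A).1 hA).1 ((memL₀ B).1 hB).1
      ((memL₀ A).1 hA).2 ((memL₀ B).1 hB).2
  have hdimL₀ : 2 * finrank ℚ L₀ = Fintype.card κ := by
    rw [hL₀, ← finrank_eq_two_mul_finrank_inf_centralizer F hξF hξu hqcen hjF hju hjξ, hdim]
  have hrkL₀ : finrank ℚ L₀ = subRank (idemSubspace (P : Matrix κ κ ℚ)) := by omega
  -- every element of `L₀` commutes with `T`, hence with `P`
  have hcommT : ∀ A ∈ L₀, A * T = T * A := by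
    intro A hA
    obtain ⟨hAF, hAξ⟩ := (memL₀ A).1 hA
    have hAa : A * a = a * A := (Subalgebra.mem_centralizer_iff ℚ |>.1 haC) A hAF
    have hAq : ξ * ξ * A = A * (ξ * ξ) := hqcen A hAF
    have hAqi : (ξ * ξ)⁻¹ * A = A * (ξ * ξ)⁻¹ := nonsing_inv_mul_comm_of_comm hqu hAq
    calc A * T = A * ξ * a * (ξ * ξ)⁻¹ := by simp only [hT_def, Matrix.mul_assoc]
      _ = ξ * (A * a) * (ξ * ξ)⁻¹ := by rw [← hAξ]; simp only [Matrix.mul_assoc]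
      _ = ξ * a * (A * (ξ * ξ)⁻¹) := by rw [hAa]; simp only [Matrix.mul_assoc]
      _ = T * A := by rw [← hAqi]; simp only [hT_def, Matrix.mul_assoc]
  have hcommP : ∀ A : L₀, Commute (⟨(A : Matrix κ κ ℚ), hF ((memL₀ A).1 A.2).1⟩ : endAlgRat Ψ) P := by
    intro A
    refine Commute.smul_right (Commute.add_right (Commute.one_right _) ?_) _
    exact Subtype.ext (hcommT A A.2)
  -- the restriction homomorphism `ψ : L₀ → End_ℚ(X^P) ⊆ M_r(ℚ)`
  let emb : L₀ → endAlgRat Ψ := fun A ↦ ⟨(A : Matrix κ κ ℚ), hF ((memL₀ A).1 A.2).1⟩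
  have emb_mul : ∀ A B : L₀, emb (A * B) = emb A * emb B := fun A B ↦ Subtype.ext rfl
  let ψ : L₀ →ₐ[ℚ] Matrix (Fin (subRank (idemSubspace (P : Matrix κ κ ℚ))))
      (Fin (subRank (idemSubspace (P : Matrix κ κ ℚ)))) ℚ :=
    { toFun := fun A ↦ restrictEnd Ψ P (emb A)
      map_one' := restrictEnd_one hPi
      map_mul' := fun A B ↦ by
        change restrictEnd Ψ P (emb (A * B)) = restrictEnd Ψ P (emb A) * restrictEnd Ψ P (emb B)
        rw [emb_mul, restrictEnd_mul hPi _ (hcommP B)]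
      map_zero' := by
        simp only [restrictEnd, emb]
        rw [Subalgebra.coe_zero, Matrix.zero_mul, toSubtorusEnd_zero]
      map_add' := fun A B ↦ by
        simp only [restrictEnd, emb]
        rw [Subalgebra.coe_add, Matrix.add_mul, toSubtorusEnd_add]
      commutes' := fun r ↦ by
        simp only [restrictEnd, emb]
        rw [Algebra.algebraMap_eq_smul_one, Algebra.algebraMap_eq_smul_one, Subalgebra.coe_smul,
          Subalgebra.coe_one, Matrix.smul_mul, toSubtorusEnd_smul, Matrix.one_mul]
        have h1 := restrictEnd_one (Φ := Ψ) hPi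
        rw [restrictEnd, Subalgebra.coe_one, Matrix.one_mul] at h1
        rw [h1] }
  have hψ : ∀ A : L₀, ψ A = restrictEnd Ψ P (emb A) := fun A ↦ rfl
  -- `ψ(A)` is invertible for `A ≠ 0`
  have hr : 0 < subRank (idemSubspace (P : Matrix κ κ ℚ)) := by
    have : 0 < Fintype.card κ := Fintype.card_pos
    omega
  haveI : Nonempty (Fin (subRank (idemSubspace (P : Matrix κ κ ℚ)))) := ⟨⟨0, hr⟩⟩
  have hunit : ∀ A : L₀, A ≠ 0 → IsUnit (ψ A) := by
    intro A hA0
    obtain ⟨hAF, hAξ⟩ := (memL₀ A).1 A.2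
    have hA0' : (A : Matrix κ κ ℚ) ≠ 0 := fun h ↦ hA0 (Subtype.ext h)
    have hAu : IsUnit (A : Matrix κ κ ℚ).det := (Matrix.isUnit_iff_isUnit_det _).1 (hdiv _ hAF hA0')
    have hinvL : (A : Matrix κ κ ℚ)⁻¹ ∈ L₀ :=
      (memL₀ _).2 ⟨nonsing_inv_mem_subalgebra F hAF hAu, (nonsing_inv_mul_comm_of_comm hAu hAξ.symm).symm⟩
    have h1 : ψ A * ψ ⟨_, hinvL⟩ = 1 := by
      rw [← map_mul, ← map_one ψ]
      congr 1
      exact Subtype.ext (Matrix.mul_nonsing_inv _ hAu)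
    exact (Matrix.isUnit_iff_isUnit_det _).2 (Matrix.isUnit_det_of_right_inverse h1)
  have hinj : Function.Injective ψ := by
    rw [injective_iff_map_eq_zero]
    intro A hA
    by_contra hA0
    exact not_isUnit_zero (hA ▸ hunit A hA0)
  refine ⟨ψ.range, ?_, ?_, ?_, ?_⟩
  · rintro x ⟨A, rfl⟩
    change restrictEnd Ψ P (emb A) ∈ _
    exact restrictEnd_mem_endAlgRat (hcommP A)
  · rintro x ⟨A, rfl⟩ y ⟨B, rfl⟩
    change ψ A * ψ B = ψ B * ψ A
    rw [← map_mul, ← map_mul]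
    exact congrArg ψ (Subtype.ext (hcommL₀ _ A.2 _ B.2))
  · rintro x ⟨A, rfl⟩ hx0
    have hx0' : ψ A ≠ 0 := hx0
    change IsUnit (ψ A)
    exact hunit A fun h ↦ hx0' (by rw [h, map_zero])
  · exact (AlgEquiv.ofInjective ψ hinj).toLinearEquiv.finrank_eq.symm.trans hrkL₀

end Restriction

/-! ## §5 The centre is totally real and `L = Z(F)(ξ)` is a CM field (add-only rider, p18 gen 10)

The involution `†` restricted to `F` sorts `F ⊇ L = F ∩ C(ξ) ⊇ Z(F)` exactly as Lange Thm. 2.6.5 (c) /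
Lemma 2.6.6 print it: `Z(F)` is the `†`-fixed part (first kind), `L` is `†`-stable with `ξ† = -ξ ≠ ξ`; so
for any number field `K` embedded onto `Z(F)`, resp. onto `L`, the tree's `ComplexTorusRosatiCM`
(`forall_rosati_algHom_eq_iff_isTotallyReal`, `isCMField_of_rosati_ne`) makes `K` totally real, resp. a CM
field — "`Y = X^P` has complex multiplication by the CM field `Z(F)(ξ)`". -/

section CMType

variable {κ : Type} [Fintype κ] [DecidableEq κ] [Nonempty κ] {E : Type*} [NormedAddCommGroup E]
  [NormedSpace ℂ E] {Ψ : (κ → ℝ) ≃L[ℝ] E} {η : E [⋀^Fin 2]→L[ℝ] ℝ} {G : Matrix κ κ ℚ}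

omit [Nonempty κ] in
/-- `L = F ∩ C(ξ)` is `†`-stable for a `†`-skew `ξ` (`(ξA)† = A†ξ† = -A†ξ`). [cite: Lange2023AbelianVarietiesComplex, §2.6.2 Thm. 2.6.5 (c) and Lemma 2.6.6 (PDF p0141, p0144)] -/
theorem rosati_mem_inf_centralizer_of_skew (F : Subalgebra ℚ (Matrix κ κ ℚ)) (hGu : IsUnit G.det)
    (hFr : ∀ A ∈ F, rosati G A ∈ F) {ξ : Matrix κ κ ℚ} (hξskew : rosati G ξ = -ξ) {A : Matrix κ κ ℚ}
    (hA : A ∈ F ⊓ Subalgebra.centralizer ℚ ({ξ} : Set (Matrix κ κ ℚ))) :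
    rosati G A ∈ F ⊓ Subalgebra.centralizer ℚ ({ξ} : Set (Matrix κ κ ℚ)) := by
  rw [Algebra.mem_inf, Subalgebra.mem_centralizer_iff] at hA ⊢
  simp only [Set.mem_singleton_iff, forall_eq] at hA ⊢
  refine ⟨hFr A hA.1, ?_⟩
  have h := congrArg (rosati G) hA.2
  rw [rosati_mul hGu, rosati_mul hGu, hξskew, Matrix.mul_neg, Matrix.neg_mul, neg_inj] at h
  exact h.symm

/-- **The centre `Z(F)` is a totally real field**: for a number field `K` and a `ℚ`-algebra embedding
`f : K → M_κ(ℚ)` with image `Z(F) = F ∩ C(F)` (so `f(K) ⊆ End_ℚ(X)`), `†` is the identity on `f(K)` (first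
kind), hence `K` is totally real (the tree's `forall_rosati_algHom_eq_iff_isTotallyReal`: a positive pair
`(K, id)` is totally real, Lange Lemma 2.6.4).
[cite: Lange2023AbelianVarietiesComplex, §2.6.2 Lemma 2.6.4 and Thm. 2.6.5 ("`K` is a totally real number field"), PDF p0141]
[cite: HulekLaface2019PicardNumbersAV, §2 (type III: `K` totally real, `e = [K:ℚ]`) (arXiv p. 4)] -/
theorem isTotallyReal_of_range_eq_center_of_typeIII_sub (hη : IsRiemannForm Ψ η)
    (hG : G.map (Rat.cast : ℚ → ℝ) = latticeGram Ψ η) (F : Subalgebra ℚ (Matrix κ κ ℚ))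
    (hF : F ≤ endAlgRat Ψ) (hfk : ∀ z ∈ F, (∀ B ∈ F, z * B = B * z) → rosati G z = z)
    {K : Type*} [Field K] [NumberField K] (f : K →ₐ[ℚ] Matrix κ κ ℚ)
    (hf : f.range = F ⊓ Subalgebra.centralizer ℚ (F : Set (Matrix κ κ ℚ))) :
    NumberField.IsTotallyReal K := by
  have hmem : ∀ x, f x ∈ F ⊓ Subalgebra.centralizer ℚ (F : Set (Matrix κ κ ℚ)) := fun x ↦
    hf ▸ (AlgHom.mem_range f).2 ⟨x, rfl⟩
  have hfE : ∀ x, f x ∈ endAlgRat Ψ := fun x ↦ hF (Algebra.mem_inf.1 (hmem x)).1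
  have hfix : ∀ x, rosati G (f x) = f x := fun x ↦ by
    obtain ⟨hxF, hxc⟩ := Algebra.mem_inf.1 (hmem x)
    exact hfk _ hxF fun B hB ↦ ((Subalgebra.mem_centralizer_iff ℚ).1 hxc B hB).symm
  exact (forall_rosati_algHom_eq_iff_isTotallyReal Ψ hη.1 hη.2.2 hG f hfE fun x ↦ ⟨x, hfix x⟩).1 hfix

/-- **`L = Z(F)(ξ)` is a CM field and `Y = X^P` has complex multiplication by it.**  Under the type-III
hypotheses of `exists_isIsogenous_powPeriod_two_of_typeIII_sub` there is a non-zero `†`-skew `ξ ∈ F` such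
that the commutative field `L = F ∩ C(ξ)` (dimension `2e = ½ rk Λ`, `mul_comm_of_commute_skew`,
`card_eq_four_mul_finrank_center_of_typeIII_sub`) is `†`-stable with `†|_L ≠ id`, and consequently EVERY
number field `K` embedded onto `L` by a `ℚ`-algebra map is a CM field (the tree's `isCMField_of_rosati_ne`:
a Rosati-stable embedded field on which `†` is not the identity is CM, Lange Lemma 2.6.6).  This is the
CM structure of the factor `Y` of `X ∼ Y × Y` (the restriction `L → End_ℚ(X^P)` of
`exists_isIsogenous_powPeriod_two_cm_of_typeIII_sub` is an injective `ℚ`-algebra map).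
[cite: HulekLaface2019PicardNumbersAV, §5.1 Prop. 5.1, exceptional case (1) (arXiv p. 10)]
[cite: Lange2023AbelianVarietiesComplex, §2.6.2 Lemma 2.6.6 (a positive pair of the second kind has CM centre), PDF p0144]
[cite: Shimura1998, §5.1 Lemma 2 and Prop. 5 (pp. 36–37)] -/
theorem exists_skew_isCMField_of_typeIII_sub (hη : IsRiemannForm Ψ η)
    (hG : G.map (Rat.cast : ℚ → ℝ) = latticeGram Ψ η) (F : Subalgebra ℚ (Matrix κ κ ℚ))
    (hF : F ≤ endAlgRat Ψ) (hFr : ∀ A ∈ F, rosati G A ∈ F) (hdiv : ∀ A ∈ F, A ≠ 0 → IsUnit A)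
    (hcen : ∀ A ∈ F, ∀ B ∈ F, (A + rosati G A) * B = B * (A + rosati G A))
    (hfk : ∀ z ∈ F, (∀ B ∈ F, z * B = B * z) → rosati G z = z)
    (hdim : finrank ℚ F = Fintype.card κ) :
    ∃ ξ ∈ F, ξ ≠ 0 ∧ rosati G ξ = -ξ ∧
      ξ ∈ F ⊓ Subalgebra.centralizer ℚ ({ξ} : Set (Matrix κ κ ℚ)) ∧
      (∀ A ∈ F ⊓ Subalgebra.centralizer ℚ ({ξ} : Set (Matrix κ κ ℚ)),
        ∀ B ∈ F ⊓ Subalgebra.centralizer ℚ ({ξ} : Set (Matrix κ κ ℚ)), A * B = B * A) ∧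
      (∀ A ∈ F ⊓ Subalgebra.centralizer ℚ ({ξ} : Set (Matrix κ κ ℚ)),
        rosati G A ∈ F ⊓ Subalgebra.centralizer ℚ ({ξ} : Set (Matrix κ κ ℚ))) ∧
      4 * finrank ℚ ↥(F ⊓ Subalgebra.centralizer ℚ ({ξ} : Set (Matrix κ κ ℚ))) = 2 * Fintype.card κ ∧
      ∀ (K : Type) [Field K] [NumberField K] (f : K →ₐ[ℚ] Matrix κ κ ℚ),
        f.range = F ⊓ Subalgebra.centralizer ℚ ({ξ} : Set (Matrix κ κ ℚ)) → NumberField.IsCMField K := by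
  have hGu : IsUnit G.det := isUnit_det_of_map_ratCast hG hη.isUnit_det_latticeGram
  have hGt : Gᵀ = -G := transpose_eq_neg_of_map_ratCast Ψ hG
  obtain ⟨ξ, hξF, a, -, j, hjF, hξ0, hξskew, hqcen, -, -, -, -, -, -, hj0, hjξ⟩ :=
    exists_skew_data_of_typeIII_sub hη hG F hF hFr hdiv hcen hfk hdim
  have hξu : IsUnit ξ.det := (Matrix.isUnit_iff_isUnit_det _).1 (hdiv ξ hξF hξ0)
  have hju : IsUnit j.det := (Matrix.isUnit_iff_isUnit_det _).1 (hdiv j hjF hj0)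
  have memL : ∀ A : Matrix κ κ ℚ, A ∈ F ⊓ Subalgebra.centralizer ℚ ({ξ} : Set (Matrix κ κ ℚ)) ↔
      A ∈ F ∧ ξ * A = A * ξ := by
    intro A
    rw [Algebra.mem_inf, Subalgebra.mem_centralizer_iff]
    simp only [Set.mem_singleton_iff, forall_eq]
  refine ⟨ξ, hξF, hξ0, hξskew, (memL ξ).2 ⟨hξF, rfl⟩, ?_, ?_, ?_, ?_⟩
  · intro A hA B hB
    exact mul_comm_of_commute_skew F hGu hGt hFr hcen hξF hξskew hξu ((memL A).1 hA).1 ((memL B).1 hB).1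
      ((memL A).1 hA).2 ((memL B).1 hB).2
  · exact fun A hA ↦ rosati_mem_inf_centralizer_of_skew F hGu hFr hξskew hA
  · rw [← hdim, finrank_eq_two_mul_finrank_inf_centralizer F hξF hξu hqcen hjF hju hjξ]
    ring
  · intro K _ _ f hf
    have hmem : ∀ x, f x ∈ F ⊓ Subalgebra.centralizer ℚ ({ξ} : Set (Matrix κ κ ℚ)) := fun x ↦
      hf ▸ (AlgHom.mem_range f).2 ⟨x, rfl⟩
    have hfE : ∀ x, f x ∈ endAlgRat Ψ := fun x ↦ hF ((memL _).1 (hmem x)).1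
    have hst : ∀ x, ∃ y, rosati G (f x) = f y := fun x ↦ by
      have h := rosati_mem_inf_centralizer_of_skew F hGu hFr hξskew (hmem x)
      rw [← hf, AlgHom.mem_range] at h
      obtain ⟨y, hy⟩ := h
      exact ⟨y, hy.symm⟩
    obtain ⟨x, hx⟩ : ∃ x, f x = ξ := by
      have h := (memL ξ).2 ⟨hξF, rfl⟩
      rw [← hf, AlgHom.mem_range] at h
      exact h
    refine isCMField_of_rosati_ne Ψ hη.1 hη.2.2 hG f hfE hst ⟨x, ?_⟩
    rw [hx, hξskew]
    intro h
    have h2 : (2 : ℚ) • ξ = 0 := by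
      rw [two_smul]
      nth_rw 1 [← h]
      exact neg_add_cancel ξ
    exact hξ0 ((smul_eq_zero.1 h2).resolve_left two_ne_zero)

end CMType






end ComplexTorus

end Literature.Geometry.Kaehler
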